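import Literature.NumberTheory.Automorphic.ShimuraCurveLocalUnitNorms
import Literature.NumberTheory.Automorphic.BrandtXi
import Literature.NumberTheory.Automorphic.BrandtModuleDictionary
import Literature.NumberTheory.Automorphic.DefiniteMaximalOrdersLeftOrderFibres
import Literature.NumberTheory.Automorphic.DefiniteOrderUnitsFinite
import Literature.NumberTheory.Automorphic.BrandtMatrixThetaSeries
import Literature.NumberTheory.Automorphic.BrandtThetaSeriesClassFunction
import Literature.NumberTheory.ModularForms.SiegelThetaMultiplierGaussSum
import Literature.NumberTheory.ModularForms.SiegelThetaMultiplierCyclotomic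
import Literature.NumberTheory.EllipticCurves.ModularFormsGamma0Genus
import Mathlib.NumberTheory.ModularForms.CuspFormSubmodule
import Mathlib.LinearAlgebra.Matrix.ToLin
import Literature.NumberTheory.Automorphic.BrandtSetupAdmissible
import HarnessLib

/-!
# Stub-ideas k=1 · GEN 9 · H1 COMPLETE — `∀ S i j k l, IsCuspForm (Θ_ij − Θ_kl)` for every Brandt setup, kernel-checked

Family 1 RECOGNISE & IMPORT, crux `SteinbergCore`, line `p6_tamagawa_split`, stub `stub_xiDegreeComparison`.
This file is the CONCATENATION (verbatim, each in its own namespace — the Cruxes workfiles are not importable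
modules, hence one file) of

* gen 7  `STUB_IDEAS_stub_xiDegreeComparison_1_g7_Sketch.lean` (ns `…StubIdeasK1G7`, 0 sorries):
         B2 — unit residues mod `p^e` are reduced norms from `O` at `p ∤ N⁻`;
* gen 9  `STUB_IDEAS_stub_xiDegreeComparison_1_g9_Sketch.lean` (ns `…StubIdeasK1G9`, 0 sorries):
         B5 ⟸ (N⁺,N⁻)=1 + B2 — the arithmetic sublattice datum `ᵗU [T_ij] U = n [T_il]`, `U V = n·1`,
         `n ⊥ c`, `n ≡ 1 (mod (c, N/(N,c)))` (one lattice CRT on `(I_j : I_l)_L` + `toMatrix` bookkeeping);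
* gen 8  `STUB_IDEAS_stub_xiDegreeComparison_1_g8_Sketch.lean` (ns `…StubIdeasK1G8`, 0 sorries):
         H1 ⟸ B5 (`brandtTheta_sub_isCuspForm_of_B5`: cusp values of `Θ_ij ∣₂ γ` via Andrianov–Zhuravlev, Siegel
         Gauss sums, the `Γ₀(N)`-double-coset lemma C1);

followed by the assembly (ns `…StubIdeasK1G9`, end of file):

  `b2Statement_holds : B2Statement S`                                              (gen 7, rebound)
  `brandtTheta_sub_isCuspForm (hcop : N⁺.Coprime N⁻) (i j k l)`                    (gen 8 ∘ gen 9 ∘ gen 7)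
  `brandtTheta_sub_isCuspForm' (S) (i j k l) : IsCuspForm (S.brandtTheta i j − S.brandtTheta k l)`  — UNCONDITIONAL
      (`NeZero (N⁺N⁻)` from `XiSetup.nplus_pos`/`S.squarefree`, `(N⁺,N⁻)=1` from the tree's `XiSetup.coprime`)
  `thetaTransfer_H1` : k2's Prop `ThetaTransferG3.brandtTheta_sub_isCuspForm`, VERBATIM, proved.

So H1 — the one residual NAMED FACT of the converged k1+k2+k3 chain for `stub_xiDegreeComparison` (k2 gen 3/4:
`stub_xiDegreeComparison_of_thetaTransfer (hΘ : H1) (hMK) (hARS) (hMod)` closes the stub with `C = 1`) — is a THEOREM: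
axioms of `thetaTransfer_H1` = {propext, Classical.choice, Quot.sound}.  Evidence file of stub-ideation k=1 (gen 9);
not a proposal — a prover lands it as Theorems files split per section (D-0064: g7 ≈ 3 decls, g9 ≈ 15, g8 ≈ 45).
-/

noncomputable section

-- ════════ gen 7 (verbatim) ════════

namespace Summit.ABC.ABC.Cruxes.SteinbergCore.StubIdeasK1G7

open Literature.NumberTheory.Automorphic

variable {Nplus Nminus : ℕ} (S : Brandt.XiSetup Nplus Nminus)

/-- **B2a (port of `ShimuraCurveData.exists_eichler_model_localAt`)**: at `p ∤ N⁻`, `O₍ₚ₎` is a standard local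
Eichler order in some matrix model. [cite: VignerasLNM800, Ch. II §2 Thm. 2.3 (2) and Lemme 2.4] -/
theorem exists_eichler_model_localAt (hN : 0 < Nplus) {p : ℕ} [hp : Fact p.Prime] (hpN : ¬ p ∣ Nminus) :
    ∃ (Ψ : S.D →ₐ[ℚ] Matrix (Fin 2) (Fin 2) ℚ_[p]) (e : ℕ),
      ∀ x : S.D, x ∈ localAt p S.O ↔ (∀ i j, ‖Ψ x i j‖ ≤ 1) ∧ ‖Ψ x 1 0‖ ≤ (p : ℝ) ^ (-(e : ℤ)) := by
  have hdiv : ∀ x : S.D, x ≠ 0 → IsUnit x := fun x hx => isUnit_of_isTotallyDefinite S.D S.isTotallyDefinite hx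
  have hEO : IsEichlerOrder S.O Nplus := isEichlerOrder_iff_brandt.mpr S.isEichlerOrder
  obtain ⟨φ⟩ := exists_algHom_matrix_of_not_dvd S.mem_ramifiedPlaces_iff' hpN
  by_cases hpM : p ∣ Nplus
  · obtain ⟨O₁, O₂, hO₁, hO₂, hO, -⟩ := hEO
    obtain ⟨Ψ, e, -, hΛe⟩ := exists_eichler_model hdiv hO₁ hO₂ φ
    refine ⟨Ψ, e, fun x => ?_⟩
    rw [hO]
    exact hΛe x
  · obtain ⟨O₁, hO₁, -, hloc⟩ := hEO.exists_isMaximalZOrder_localAt_eq hN.ne' hp.out hpM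
    obtain ⟨u, hu⟩ := hO₁.exists_conjUnit_localAt_iff hdiv φ
    refine ⟨AlgHom.conjUnit φ u, 0, fun x => ?_⟩
    rw [hloc, hu x]
    simp only [CharP.cast_eq_zero, neg_zero, zpow_zero]
    exact ⟨fun h => ⟨h, h 1 0⟩, fun h => h.1⟩

/-- **B2b (port of `ShimuraCurveData.exists_mem_localAt_reducedNorm_eq_mul_of_not_dvd`)**: for `p ∤ N⁻`, a rational
`u` with `v_p(u) = 0` and `m ≥ 0` there is `g ∈ O₍ₚ₎` with `nrd g = u (1 + p^m r)`, `r ∈ ℤ₍ₚ₎` (approximate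
surjectivity of `nrd : O_pˣ → ℤ_pˣ` for local Eichler orders). [cite: VignerasLNM800, Ch. II §2 and Ch. III §5 Cor. 5.7] -/
theorem exists_mem_localAt_reducedNorm_eq_mul_of_not_dvd (hN : 0 < Nplus) {p : ℕ}
    (hp : p.Prime) (hpN : ¬ p ∣ Nminus) {u : ℚ} (hu0 : u ≠ 0) (hu : padicValRat p u = 0) (m : ℕ) :
    ∃ g : S.D, g ∈ localAt p S.O ∧ ∃ r : ℚ, ¬ p ∣ r.den ∧
      reducedNorm ℚ S.D g = u * (1 + (p : ℚ) ^ m * r) := by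
  haveI : Fact p.Prime := ⟨hp⟩
  have hpR : (0 : ℝ) < p := by exact_mod_cast hp.pos
  have hp1 : (1 : ℝ) < p := by exact_mod_cast hp.one_lt
  have hpQ : (p : ℚ) ≠ 0 := Nat.cast_ne_zero.mpr hp.ne_zero
  obtain ⟨Ψ, e, hΛ⟩ := exists_eichler_model_localAt S hN hpN
  set T : Matrix (Fin 2) (Fin 2) ℚ_[p] := !![((u : ℚ) : ℚ_[p]), 0; 0, 1] with hT
  obtain ⟨g, hg⟩ := AlgHom.exists_norm_sub_le Ψ T (m + e)
  have hunorm : ‖((u : ℚ) : ℚ_[p])‖ = 1 := by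
    rw [Padic.norm_ratCast_eq_zpow hu0, hu, neg_zero, zpow_zero]
  have hε1 : (p : ℝ) ^ (-((m + e : ℕ) : ℤ)) ≤ 1 := zpow_le_one_of_nonpos₀ hp1.le (by omega)
  have hεe : (p : ℝ) ^ (-((m + e : ℕ) : ℤ)) ≤ (p : ℝ) ^ (-(e : ℤ)) :=
    zpow_le_zpow_right₀ hp1.le (by push_cast; omega)
  have hTnorm : ∀ i j, ‖T i j‖ ≤ 1 := by
    intro i j
    fin_cases i <;> fin_cases j <;> simp [hT, hunorm]
  set E : Matrix (Fin 2) (Fin 2) ℚ_[p] := Ψ g - T with hE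
  have hEnorm : ∀ i j, ‖E i j‖ ≤ (p : ℝ) ^ (-((m + e : ℕ) : ℤ)) := hg
  have hΨg : Ψ g = T + E := by rw [hE]; abel
  have hgΛ : g ∈ localAt p S.O := by
    rw [hΛ]
    refine ⟨fun i j => ?_, ?_⟩
    · rw [hΨg, Matrix.add_apply]
      exact (Padic.nonarchimedean _ _).trans (max_le (hTnorm i j) ((hEnorm i j).trans hε1))
    · rw [hΨg, Matrix.add_apply]
      have hT10 : T 1 0 = 0 := by simp [hT]
      rw [hT10, zero_add]
      exact (hEnorm 1 0).trans hεe
  have hdet : (Ψ g).det = ((u : ℚ) : ℚ_[p]) + (((u : ℚ) : ℚ_[p]) * E 1 1 + E 0 0 + E 0 0 * E 1 1 - E 0 1 * E 1 0) := by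
    rw [hΨg, Matrix.det_fin_two]
    simp only [Matrix.add_apply, hT, Matrix.of_apply, Matrix.cons_val', Matrix.cons_val_zero,
      Matrix.cons_val_one, Matrix.empty_val', Matrix.cons_val_fin_one]
    ring
  set δ : ℚ_[p] := ((u : ℚ) : ℚ_[p]) * E 1 1 + E 0 0 + E 0 0 * E 1 1 - E 0 1 * E 1 0 with hδ
  have hδnorm : ‖δ‖ ≤ (p : ℝ) ^ (-((m + e : ℕ) : ℤ)) := by
    have hε0 : (0 : ℝ) ≤ (p : ℝ) ^ (-((m + e : ℕ) : ℤ)) := zpow_nonneg hpR.le _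
    have h1 : ‖((u : ℚ) : ℚ_[p]) * E 1 1‖ ≤ (p : ℝ) ^ (-((m + e : ℕ) : ℤ)) := by
      rw [norm_mul, hunorm, one_mul]; exact hEnorm 1 1
    have h2 : ‖E 0 0 * E 1 1‖ ≤ (p : ℝ) ^ (-((m + e : ℕ) : ℤ)) := by
      rw [norm_mul]
      exact (mul_le_mul (hEnorm 0 0) ((hEnorm 1 1).trans hε1) (norm_nonneg _) hε0).trans
        (by rw [mul_one])
    have h3 : ‖E 0 1 * E 1 0‖ ≤ (p : ℝ) ^ (-((m + e : ℕ) : ℤ)) := by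
      rw [norm_mul]
      exact (mul_le_mul (hEnorm 0 1) ((hEnorm 1 0).trans hε1) (norm_nonneg _) hε0).trans
        (by rw [mul_one])
    rw [hδ, sub_eq_add_neg]
    refine (Padic.nonarchimedean _ _).trans (max_le ?_ (by rw [norm_neg]; exact h3))
    refine (Padic.nonarchimedean _ _).trans (max_le ?_ h2)
    exact (Padic.nonarchimedean _ _).trans (max_le h1 (hEnorm 0 0))
  have hnrd : ((reducedNorm ℚ S.D g : ℚ) : ℚ_[p]) - ((u : ℚ) : ℚ_[p]) = δ := by
    have h := AlgHom.det_eq_reducedNorm Ψ g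
    rw [hdet] at h
    rw [show ((reducedNorm ℚ S.D g : ℚ) : ℚ_[p]) = algebraMap ℚ ℚ_[p] (reducedNorm ℚ S.D g) from rfl,
      ← h]
    ring
  set r : ℚ := (reducedNorm ℚ S.D g - u) / (u * (p : ℚ) ^ m) with hr
  refine ⟨g, hgΛ, r, ?_, ?_⟩
  · rw [← Padic.norm_ratCast_le_one_iff, hr]
    push_cast
    rw [hnrd, norm_div, norm_mul, hunorm, one_mul, norm_pow, Padic.norm_p, inv_pow,
      div_le_one (by positivity)]
    calc ‖δ‖ ≤ (p : ℝ) ^ (-((m + e : ℕ) : ℤ)) := hδnorm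
      _ ≤ (p : ℝ) ^ (-(m : ℤ)) := zpow_le_zpow_right₀ hp1.le (by push_cast; omega)
      _ = ((p : ℝ) ^ m)⁻¹ := by rw [zpow_neg, zpow_natCast]
  · rw [hr]
    field_simp
    ring

/-- **B2 (the gen-6 signature, from B2b by clearing denominators).** With `u = t`, `m = e`: `g ∈ O₍ₚ₎`,
`nrd g = t (1 + p^e r)`; pick `s ≥ 1`, `p ∤ s`, `s • g ∈ O` (`mem_localAt_iff`) and `s' : ℤ` with `s s' ≡ 1 (mod p^e)`;
`z = s' • (s • g) ∈ O` has `nrd z = (s s')² t (1 + p^e r) ∈ ℤ` (`S.isEichlerOrder.isOrder.exists_int_reducedTrace_reducedNorm`)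
and `nrd z − t = ((s s')² − 1) t + (s s')² t p^e r ≡ 0 (mod p^e)` (the last term is an integer equal to `p^e` times a
`p`-integral rational: `padicValRat`). [cite: VignerasLNM800, Ch. II §2] -/
theorem exists_mem_order_reducedNorm_modEq_of_not_dvd {p : ℕ} [hpf : Fact p.Prime] (hp : ¬ p ∣ Nminus) (hN : 0 < Nplus)
    (e : ℕ) {t : ℤ} (ht : IsCoprime t p) :
    ∃ z ∈ S.O, ∃ nz : ℤ, reducedNorm ℚ S.D z = nz ∧ (p : ℤ) ^ e ∣ nz - t := by
  have hpp : p.Prime := hpf.out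
  have hpt : ¬ (p : ℤ) ∣ t := fun h => by
    have hu := ht.isUnit_of_dvd' h dvd_rfl
    rw [Int.isUnit_iff] at hu
    have := hpp.two_le
    omega
  have ht0 : t ≠ 0 := fun h => hpt (h ▸ dvd_zero _)
  have htQ : (t : ℚ) ≠ 0 := Int.cast_ne_zero.mpr ht0
  have hvt : padicValRat p (t : ℚ) = 0 := by
    simp [padicValRat.of_int, padicValInt.eq_zero_of_not_dvd hpt]
  obtain ⟨g, hg, r, hr, hnrd⟩ := exists_mem_localAt_reducedNorm_eq_mul_of_not_dvd S hN hpp hp htQ hvt e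
  obtain ⟨s, hs0, hsp, hsg⟩ := mem_localAt_iff.mp hg
  have hcop : IsCoprime (s : ℤ) ((p : ℤ) ^ e) := (Nat.isCoprime_iff_coprime.mpr hsp).pow_right
  obtain ⟨a, b, hab⟩ := hcop
  refine ⟨a • ((s : ℤ) • g), S.O.smul_mem a hsg, ?_⟩
  obtain ⟨-, nz, -, hnz⟩ := S.isEichlerOrder.isOrder.exists_int_reducedTrace_reducedNorm (S.O.smul_mem a hsg)
  refine ⟨nz, hnz, ?_⟩
  have hq : (nz : ℚ) = (a : ℚ) ^ 2 * ((s : ℚ) ^ 2 * ((t : ℚ) * (1 + (p : ℚ) ^ e * r))) := by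
    rw [← hnz, reducedNorm_zsmul, reducedNorm_zsmul, hnrd]; push_cast; ring
  have key : (r.den : ℤ) * (nz - t) = ((a * s) ^ 2 - 1) * t * r.den + (p : ℤ) ^ e * ((a * s) ^ 2 * t * r.num) := by
    have h : (((r.den : ℤ) * (nz - t) : ℤ) : ℚ) =
        ((((a * s) ^ 2 - 1) * t * r.den + (p : ℤ) ^ e * ((a * s) ^ 2 * t * r.num) : ℤ) : ℚ) := by
      push_cast
      rw [hq, ← Rat.mul_den_eq_num r]
      ring
    exact_mod_cast h
  have h1 : (p : ℤ) ^ e ∣ (a * s) ^ 2 - 1 := by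
    have : (a * (s : ℤ)) ^ 2 - 1 = (a * s - 1) * (a * s + 1) := by ring
    rw [this]
    exact Dvd.dvd.mul_right ⟨-b, by linear_combination hab⟩ _
  have h2 : (p : ℤ) ^ e ∣ (r.den : ℤ) * (nz - t) := by
    rw [key]
    exact dvd_add ((h1.mul_right _).mul_right _) (dvd_mul_right _ _)
  have hcop' : IsCoprime ((p : ℤ) ^ e) (r.den : ℤ) :=
    (Nat.isCoprime_iff_coprime.mpr ((Nat.Prime.coprime_iff_not_dvd hpp).mpr hr)).pow_left
  exact hcop'.dvd_of_dvd_mul_left h2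

end Summit.ABC.ABC.Cruxes.SteinbergCore.StubIdeasK1G7

-- ════════ gen 9 (verbatim) ════════

namespace Summit.ABC.ABC.Cruxes.SteinbergCore.StubIdeasK1G9

open Matrix Module
open scoped MatrixGroups Pointwise

open Literature.NumberTheory.Automorphic Literature.NumberTheory.Automorphic.Brandt

variable {Nplus Nminus : ℕ} (S : XiSetup Nplus Nminus)

/-! ## §0 Dictionary (verbatim gen 5/6/8) -/

/-- The Gram matrix `[T_{ij}]` behind `S.brandtTheta i j` (gen 8 §0, verbatim). -/
def brandtGram (i j : ClassSet S.O) : Matrix (Fin 4) (Fin 4) ℤ :=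
  normFormGram (S.nonempty_basis_transporterLeft i.rep_mem j.rep_mem).some (S.nrdGen j.rep_mem / S.nrdGen i.rep_mem)

/-- B5 (gen-6/8 signature, verbatim `StubIdeasK1G8.B5Statement`). -/
def B5Statement (i j l : ClassSet S.O) : Prop :=
  ∀ c : ℕ, 0 < c → ∃ n : ℕ, n.Coprime c ∧ n ≡ 1 [MOD Nat.gcd c ((Nplus * Nminus) / Nat.gcd (Nplus * Nminus) c)] ∧
    ∃ U V : Matrix (Fin 4) (Fin 4) ℤ,
      Uᵀ * brandtGram S i j * U = (n : ℤ) • brandtGram S i l ∧ U * V = (n : ℤ) • (1 : Matrix (Fin 4) (Fin 4) ℤ)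

/-- B2 (gen-6 signature; PROVED in gen 7 as `StubIdeasK1G7.exists_mem_order_reducedNorm_modEq_of_not_dvd`,
with `0 < N⁺` from `S.nplus_ne_zero`) as a Prop: unit residues mod `p^e` are reduced norms from `O` at `p ∤ N⁻`. -/
def B2Statement : Prop :=
  ∀ (p : ℕ), p.Prime → ¬ p ∣ Nminus → ∀ (e : ℕ) (t : ℤ), IsCoprime t p →
    ∃ z ∈ S.O, ∃ nz : ℤ, reducedNorm ℚ S.D z = nz ∧ (p : ℤ) ^ e ∣ nz - t

/-! ## §1 The gen-9 helpers (statements; sizes XS–M; each one prover cycle) -/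

/-- **H-a (B1-local, size XS–S, PROVED).** A right `O`-ideal contains an element whose normalised norm `nrd β / q_I`
is prime to a given prime `p`: otherwise every generator `nrd β` of `nrdIdeal I = ℤ q_I` lies in `ℤ (p q_I)`,
so `q_I ∈ ℤ p q_I`, absurd. [cite: Voight2021, Def. 16.3.1 and Lemma 16.3.2] -/
theorem exists_mem_reducedNorm_eq_mul_not_dvd {I : Submodule ℤ S.D} (hI : I ∈ rightIdeals S.O) {p : ℕ} (hp : p.Prime) :
    ∃ β ∈ I, ∃ m : ℤ, reducedNorm ℚ S.D β = m * S.nrdGen hI ∧ ¬ (p : ℤ) ∣ m := by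
  by_contra h
  push Not at h
  have hq := S.nrdGen_pos hI
  have hn := S.nrdIdeal_eq_span_nrdGen hI
  have hle : nrdIdeal I ≤ ℤ ∙ ((p : ℚ) * S.nrdGen hI) := by
    refine nrdIdeal_le_iff.mpr fun x hx => ?_
    obtain ⟨m, hm⟩ := S.exists_int_reducedNorm_eq_mul hn hx
    obtain ⟨k, hk⟩ := h x hx m hm
    rw [Submodule.mem_span_singleton]
    exact ⟨k, by rw [hm, hk, zsmul_eq_mul]; push_cast; ring⟩
  have hmem : S.nrdGen hI ∈ ℤ ∙ ((p : ℚ) * S.nrdGen hI) :=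
    hle (by rw [hn]; exact Submodule.mem_span_singleton_self _)
  rw [Submodule.mem_span_singleton] at hmem
  obtain ⟨k, hk⟩ := hmem
  rw [zsmul_eq_mul] at hk
  have hkp : (k : ℚ) * p = 1 := by
    have h1 : (k : ℚ) * p * S.nrdGen hI = 1 * S.nrdGen hI := by rw [mul_assoc, hk, one_mul]
    exact mul_right_cancel₀ hq.ne' h1
  have hkp' : k * (p : ℤ) = 1 := by exact_mod_cast hkp
  have hdvd : (p : ℤ) ∣ 1 := ⟨k, by rw [mul_comm]; exact hkp'.symm⟩
  have hp1 : (p : ℤ) = 1 := Int.eq_one_of_dvd_one (by positivity) hdvd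
  exact hp.ne_one (by exact_mod_cast hp1)

/-- **H-b (size S, PROVED).** `q'⁻¹ · β z β̄' ∈ (I : I')_L` for `β ∈ I`, `z ∈ O`, `β' ∈ I'`: for `m ∈ I'`, `β̄' m ∈ Ī' I' = q' O`, so
`q'⁻¹ β z β̄' m ∈ β z O ⊆ I`. [cite: Voight2021, 16.6.14 and 41.1.3] -/
theorem algebraMap_mul_mem_transporterLeft {I I' : Submodule ℤ S.D} (hI : I ∈ rightIdeals S.O) (hI' : I' ∈ rightIdeals S.O)
    {β z β' : S.D} (hβ : β ∈ I) (hz : z ∈ S.O) (hβ' : β' ∈ I') :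
    algebraMap ℚ S.D (S.nrdGen hI')⁻¹ * (β * z * standardInvolution ℚ S.D β') ∈ transporterLeft I' I := by
  obtain ⟨q, hq, hn, -, u, hu, hconj, -⟩ := S.exists_nrdIdeal_eq_span_and_latticeConj_mul_self_eq hI'
  have hqq : S.nrdGen hI' = q := S.nrdGen_eq hI' hq hn
  rw [mem_transporterLeft_iff]
  intro m hm
  have h1 : standardInvolution ℚ S.D β' * m ∈ latticeConj I' * I' :=
    Submodule.mul_mem_mul (by rw [mem_latticeConj_iff, standardInvolution_standardInvolution]; exact hβ') hm
  rw [hconj, mem_units_smul_iff_mul_mem] at h1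
  have hinv : ((u⁻¹ : S.Dˣ) : S.D) = algebraMap ℚ S.D q⁻¹ :=
    Units.inv_eq_of_mul_eq_one_right (by rw [hu, ← map_mul, mul_inv_cancel₀ hq.ne', map_one])
  rw [hinv] at h1
  have h2 : z * (algebraMap ℚ S.D q⁻¹ * (standardInvolution ℚ S.D β' * m)) ∈ S.O :=
    S.isEichlerOrder.isOrder.mul_mem _ hz _ h1
  have h3 : β * (z * (algebraMap ℚ S.D q⁻¹ * (standardInvolution ℚ S.D β' * m))) ∈ I := by
    have hz' : z * (algebraMap ℚ S.D q⁻¹ * (standardInvolution ℚ S.D β' * m)) ∈ rightOrder I := by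
      rw [hI.2.1]; exact h2
    exact hz' β hβ
  have heq : algebraMap ℚ S.D (S.nrdGen hI')⁻¹ * (β * z * standardInvolution ℚ S.D β') * m =
      β * (z * (algebraMap ℚ S.D q⁻¹ * (standardInvolution ℚ S.D β' * m))) := by
    simp only [hqq, mul_assoc, Algebra.left_comm]
  rw [heq]
  exact h3

/-- **H-b′ (size XS, PROVED).** Its reduced norm: `nrd(q'⁻¹ β z β̄') = q'⁻² nrd β · nrd z · nrd β'`. [cite: VignerasLNM800, Ch. I §1 Lemme 1.1] -/
theorem reducedNorm_algebraMap_mul (q : ℚ) (β z β' : S.D) :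
    reducedNorm ℚ S.D (algebraMap ℚ S.D q * (β * z * standardInvolution ℚ S.D β')) =
      q ^ 2 * (reducedNorm ℚ S.D β * reducedNorm ℚ S.D z * reducedNorm ℚ S.D β') := by
  rw [reducedNorm_mul_holds, reducedNorm_mul_holds, reducedNorm_mul_holds, reducedNorm_algebraMap,
    reducedNorm_standardInvolution]

/-- **H-c (lattice CRT for the norm form, size S, PROVED).** Finitely many local targets `x_p ∈ I` are met simultaneously:
`∃ y ∈ I` with `nrd y ≡ nrd x_p (mod p^{e_p} · q_I)` for all `p ∈ P` (coordinatewise CRT in `I ≅ ℤ⁴`, then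
`nrd(x + p^e d) = nrd x + p^{2e} nrd d + p^e trd(x d̄)` with `nrd d ∈ ℤ q_I`, `trd(x d̄) ∈ ℤ q_I`). [folklore] -/
theorem exists_mem_forall_pow_dvd_reducedNorm_sub {I : Submodule ℤ S.D} (hI : I ∈ rightIdeals S.O)
    (P : Finset ℕ) (hP : ∀ p ∈ P, p.Prime) (e : ℕ → ℕ) (x : ℕ → S.D) (hx : ∀ p ∈ P, x p ∈ I) :
    ∃ y ∈ I, ∀ p ∈ P, ∃ k : ℤ,
      reducedNorm ℚ S.D y - reducedNorm ℚ S.D (x p) = k * (p : ℚ) ^ e p * S.nrdGen hI := by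
  classical
  obtain ⟨b⟩ := hI.1.nonempty_basis_fin_four
  have hn := S.nrdIdeal_eq_span_nrdGen hI
  -- coordinates of the local targets in the basis `b`
  let g : P → Fin 4 → ℤ := fun p => b.repr ⟨x p, hx p p.2⟩
  -- the moduli `p ^ e p`, `p ∈ P`, are pairwise coprime
  have hcop : Pairwise fun p p' : P =>
      IsCoprime (Ideal.span {((p : ℕ) : ℤ) ^ e p}) (Ideal.span {((p' : ℕ) : ℤ) ^ e p'}) := by
    intro p p' hne
    rw [Ideal.isCoprime_span_singleton_iff]
    have hne' : (p : ℕ) ≠ p' := fun h => hne (Subtype.ext h)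
    have h0 : IsCoprime ((p : ℕ) : ℤ) ((p' : ℕ) : ℤ) :=
      Nat.isCoprime_iff_coprime.mpr ((Nat.coprime_primes (hP p p.2) (hP p' p'.2)).mpr hne')
    exact h0.pow
  -- CRT, one coordinate at a time
  have key : ∀ r : Fin 4, ∃ wr : ℤ, ∀ p : P, wr - g p r ∈ Ideal.span {((p : ℕ) : ℤ) ^ e p} :=
    fun r => Ideal.exists_forall_sub_mem_ideal (I := fun p : P => Ideal.span {((p : ℕ) : ℤ) ^ e p}) hcop (fun p => g p r)
  choose w hw using key
  have key2 : ∀ (p : P) (r : Fin 4), ∃ d : ℤ, w r - g p r = ((p : ℕ) : ℤ) ^ e p * d :=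
    fun p r => Ideal.mem_span_singleton.mp (hw r p)
  choose d hd using key2
  refine ⟨∑ r, w r • (b r : S.D), I.sum_mem fun r _ => I.smul_mem _ (b r).2, fun p hp => ?_⟩
  -- the correction `δ ∈ I` with `y = x_p + p^e • δ`
  set δ : S.D := ∑ r, d ⟨p, hp⟩ r • (b r : S.D) with hδdef
  have hδ : δ ∈ I := I.sum_mem fun r _ => I.smul_mem _ (b r).2
  have hxsum : x p = ∑ r, g ⟨p, hp⟩ r • (b r : S.D) := by
    have h := congrArg Subtype.val (b.sum_repr ⟨x p, hx p hp⟩)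
    simp only [Submodule.coe_sum, Submodule.coe_smul_of_tower] at h
    exact h.symm
  have hy : ∑ r, w r • (b r : S.D) = x p + (((p : ℕ) : ℤ) ^ e p) • δ := by
    rw [hxsum, hδdef, Finset.smul_sum, ← Finset.sum_add_distrib]
    refine Finset.sum_congr rfl fun r _ => ?_
    have hw' : w r = g ⟨p, hp⟩ r + ((p : ℕ) : ℤ) ^ e p * d ⟨p, hp⟩ r := by
      have h := hd ⟨p, hp⟩ r; linear_combination h
    rw [hw', add_smul, mul_smul]
  have hmain : reducedNorm ℚ S.D (∑ r, w r • (b r : S.D)) - reducedNorm ℚ S.D (x p) =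
      ((p : ℚ) ^ e p) ^ 2 * reducedNorm ℚ S.D δ +
        (p : ℚ) ^ e p * reducedTrace ℚ S.D (x p * standardInvolution ℚ S.D δ) := by
    rw [hy, ← Int.cast_smul_eq_zsmul ℚ, reducedNorm_add, reducedNorm_smul, standardInvolution_smul, mul_smul_comm,
      map_smul, smul_eq_mul]
    push_cast
    ring
  obtain ⟨a, ha⟩ := S.exists_int_reducedNorm_eq_mul hn hδ
  obtain ⟨b', hb'⟩ := S.exists_int_reducedTrace_mul_standardInvolution_eq_mul hn (hx p hp) hδ
  refine ⟨(p : ℤ) ^ e p * a + b', ?_⟩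
  rw [hmain, ha, hb']
  push_cast
  ring

/-- **H-d (= gen-6 B4, size S, PROVED).** The involution swaps Eichler's lattices up to the scalar `q'/q`:
`y ∈ (I : I')_L = q'⁻¹ I Ī'` ⇒ `ȳ ∈ q'⁻¹ I' Ī = (q/q') (I' : I)_L`
(tree `XiSetup.exists_transporterLeft_eq_units_inv_smul_mul_latticeConj` twice, `latticeConj_mul`,
`latticeConj_latticeConj`, `standardInvolution_algebraMap`). [cite: Voight2021, 41.1.3 and 16.6.14] -/
theorem smul_standardInvolution_mem_transporterLeft {I I' : Submodule ℤ S.D} (hI : I ∈ rightIdeals S.O)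
    (hI' : I' ∈ rightIdeals S.O) {y : S.D} (hy : y ∈ transporterLeft I' I) :
    algebraMap ℚ S.D (S.nrdGen hI' / S.nrdGen hI) * standardInvolution ℚ S.D y ∈ transporterLeft I I' := by
  obtain ⟨q', u', hq', hn', hu', h'⟩ := S.exists_transporterLeft_eq_units_inv_smul_mul_latticeConj hI hI'
  obtain ⟨q, u, hq, hn, hu, h⟩ := S.exists_transporterLeft_eq_units_inv_smul_mul_latticeConj hI' hI
  have hq'e : S.nrdGen hI' = q' := S.nrdGen_eq hI' hq' hn'
  have hqe : S.nrdGen hI = q := S.nrdGen_eq hI hq hn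
  rw [h', mem_units_smul_iff_mul_mem, inv_inv, hu'] at hy
  rw [h, mem_units_smul_iff_mul_mem, inv_inv, hu, hq'e, hqe]
  have hqq : q * (q' / q) = q' := by field_simp
  have hprod : algebraMap ℚ S.D q * (algebraMap ℚ S.D (q' / q) * standardInvolution ℚ S.D y) =
      standardInvolution ℚ S.D (algebraMap ℚ S.D q' * y) := by
    rw [← mul_assoc, ← map_mul, hqq, standardInvolution_mul_rev, standardInvolution_algebraMap, ← Algebra.commutes]
  have hmem : standardInvolution ℚ S.D (algebraMap ℚ S.D q' * y) ∈ latticeConj (I * latticeConj I') := by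
    rw [mem_latticeConj_iff, standardInvolution_standardInvolution]; exact hy
  rw [latticeConj_mul, latticeConj_latticeConj] at hmem
  rw [hprod]
  exact hmem

/-- Entry formula `(ᵗU G U)_{st} = U_{·s} ⬝ (G U_{·t})` (bookkeeping for H-e). -/
theorem transpose_mul_mul_apply {m : Type*} [Fintype m] (U G : Matrix m m ℤ) (s t : m) :
    (Uᵀ * G * U) s t = (fun r => U r s) ⬝ᵥ (G *ᵥ fun r => U r t) := by
  rw [Matrix.mul_assoc]
  simp only [Matrix.mul_apply, Matrix.transpose_apply, dotProduct, mulVec]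

/-- **H-e (= B5b, basis bookkeeping, size M, PROVED).** Any `y ∈ (I_j : I_l)_L` with `Q_{lj}(y) = nrd(y) q_l/q_j = n` gives the
sublattice datum: `U` = matrix of `w ↦ y w : (I_l : I_i)_L → (I_j : I_i)_L` in the bases behind `brandtGram`, `V` = matrix of
`x ↦ (q_l/q_j) ȳ x` back (H-d); `ᵗU [T_ij] U = n [T_il]` because `trd((y b_s)(y b_t)‾) = nrd(y) trd(b_s b̄_t)`, and
`U V = n · 1` because `y · (q_l/q_j) ȳ = n`. [cite: Voight2021, §40.4 (p. 744) and 41.1.3] -/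
theorem exists_gram_datum_of_mem_transporterLeft (i j l : ClassSet S.O) {y : S.D} (hy : y ∈ transporterLeft l.rep j.rep)
    {n : ℕ} (hn : reducedNorm ℚ S.D y * S.nrdGen l.rep_mem = n * S.nrdGen j.rep_mem) :
    ∃ U V : Matrix (Fin 4) (Fin 4) ℤ,
      Uᵀ * brandtGram S i j * U = (n : ℤ) • brandtGram S i l ∧ U * V = (n : ℤ) • (1 : Matrix (Fin 4) (Fin 4) ℤ) := by
  classical
  set qi := S.nrdGen i.rep_mem with hqi
  set qj := S.nrdGen j.rep_mem with hqj
  set ql := S.nrdGen l.rep_mem with hql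
  have hqi0 : 0 < qi := S.nrdGen_pos i.rep_mem
  have hqj0 : 0 < qj := S.nrdGen_pos j.rep_mem
  have hql0 : 0 < ql := S.nrdGen_pos l.rep_mem
  set bij := (S.nonempty_basis_transporterLeft i.rep_mem j.rep_mem).some with hbij
  set bil := (S.nonempty_basis_transporterLeft i.rep_mem l.rep_mem).some with hbil
  have hGij : brandtGram S i j = normFormGram bij (qj / qi) := rfl
  have hGil : brandtGram S i l = normFormGram bil (ql / qi) := rfl
  have hnij : nrdIdeal (transporterLeft i.rep j.rep) = ℤ ∙ (qj / qi) :=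
    S.nrdIdeal_transporterLeft j.rep_mem i.rep_mem hqj0 hqi0 (S.nrdIdeal_eq_span_nrdGen j.rep_mem)
      (S.nrdIdeal_eq_span_nrdGen i.rep_mem)
  have hnil : nrdIdeal (transporterLeft i.rep l.rep) = ℤ ∙ (ql / qi) :=
    S.nrdIdeal_transporterLeft l.rep_mem i.rep_mem hql0 hqi0 (S.nrdIdeal_eq_span_nrdGen l.rep_mem)
      (S.nrdIdeal_eq_span_nrdGen i.rep_mem)
  have hAij : ∀ r s, ((normFormGram bij (qj / qi) r s : ℤ) : ℚ) * (qj / qi) =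
      reducedTrace ℚ S.D ((bij r : S.D) * standardInvolution ℚ S.D (bij s : S.D)) :=
    fun r s => S.cast_normFormGram_mul (div_pos hqj0 hqi0).ne' hnij bij r s
  have hAil : ∀ r s, ((normFormGram bil (ql / qi) r s : ℤ) : ℚ) * (ql / qi) =
      reducedTrace ℚ S.D ((bil r : S.D) * standardInvolution ℚ S.D (bil s : S.D)) :=
    fun r s => S.cast_normFormGram_mul (div_pos hql0 hqi0).ne' hnil bil r s
  -- `y' := (q_l/q_j) ȳ ∈ (I_l : I_j)_L` with `y y' = n`, `ȳ y = nrd y`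
  set y' := algebraMap ℚ S.D (ql / qj) * standardInvolution ℚ S.D y with hy'def
  have hy' : y' ∈ transporterLeft j.rep l.rep :=
    smul_standardInvolution_mem_transporterLeft S j.rep_mem l.rep_mem hy
  have hsc : ql / qj * reducedNorm ℚ S.D y = n := by
    field_simp
    linear_combination hn
  have hyy' : y * y' = (n : S.D) := by
    rw [hy'def, Algebra.left_comm, mul_standardInvolution_holds ℚ S.D y, ← map_mul, hsc, map_natCast]
  have hbar : standardInvolution ℚ S.D y * y = algebraMap ℚ S.D (reducedNorm ℚ S.D y) := by
    have h := mul_standardInvolution_holds ℚ S.D (standardInvolution ℚ S.D y)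
    rwa [standardInvolution_standardInvolution, reducedNorm_standardInvolution] at h
  -- the two lattice maps
  have hf : ∀ w ∈ transporterLeft i.rep l.rep, y * w ∈ transporterLeft i.rep j.rep := fun w hw m hm => by
    rw [mul_assoc]; exact hy _ (hw m hm)
  have hg : ∀ x ∈ transporterLeft i.rep j.rep, y' * x ∈ transporterLeft i.rep l.rep := fun x hx m hm => by
    rw [mul_assoc]; exact hy' _ (hx m hm)
  set f : transporterLeft i.rep l.rep →ₗ[ℤ] transporterLeft i.rep j.rep := (LinearMap.mulLeft ℤ y).restrict hf
    with hfdef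
  set g : transporterLeft i.rep j.rep →ₗ[ℤ] transporterLeft i.rep l.rep := (LinearMap.mulLeft ℤ y').restrict hg
    with hgdef
  have hf_apply : ∀ w, ((f w : transporterLeft i.rep j.rep) : S.D) = y * w := fun w => rfl
  have hg_apply : ∀ x, ((g x : transporterLeft i.rep l.rep) : S.D) = y' * x := fun x => rfl
  have hfg : f.comp g = (n : ℤ) • LinearMap.id := by
    refine LinearMap.ext fun x => Subtype.ext ?_
    simp only [LinearMap.comp_apply, LinearMap.smul_apply, LinearMap.id_apply, Submodule.coe_smul_of_tower]
    rw [hf_apply, hg_apply, ← mul_assoc, hyy', natCast_zsmul, nsmul_eq_mul]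
  refine ⟨LinearMap.toMatrix bil bij f, LinearMap.toMatrix bij bil g, ?_, ?_⟩
  · -- the Gram identity `ᵗU [T_ij] U = n [T_il]`
    have hcol : ∀ t, ((bij.equivFun.symm (fun r => LinearMap.toMatrix bil bij f r t) : transporterLeft i.rep j.rep) : S.D)
        = y * (bil t : S.D) := by
      intro t
      have h : (fun r => LinearMap.toMatrix bil bij f r t) = ⇑(bij.repr (f (bil t))) := by
        funext r; rw [LinearMap.toMatrix_apply]
      rw [h, Basis.equivFun_symm_apply, Basis.sum_repr, hf_apply]
    ext s t
    rw [hGij, hGil, transpose_mul_mul_apply, Matrix.smul_apply, smul_eq_mul]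
    have h1 := S.cast_dotProduct_normFormGram_mulVec hAij (fun r => LinearMap.toMatrix bil bij f r s)
      (fun r => LinearMap.toMatrix bil bij f r t)
    rw [hcol, hcol] at h1
    have h2 : reducedTrace ℚ S.D ((y * (bil s : S.D)) * standardInvolution ℚ S.D (y * (bil t : S.D))) =
        reducedNorm ℚ S.D y * reducedTrace ℚ S.D ((bil s : S.D) * standardInvolution ℚ S.D (bil t : S.D)) := by
      rw [standardInvolution_mul_rev]
      have h3 : y * (bil s : S.D) * (standardInvolution ℚ S.D (bil t : S.D) * standardInvolution ℚ S.D y)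
          = (y * ((bil s : S.D) * standardInvolution ℚ S.D (bil t : S.D))) * standardInvolution ℚ S.D y := by
        simp only [mul_assoc]
      rw [h3, reducedTrace_mul_comm, ← mul_assoc, hbar, ← Algebra.smul_def, map_smul, smul_eq_mul]
    have hne : (qj / qi : ℚ) ≠ 0 := (div_pos hqj0 hqi0).ne'
    have h4 : ((((fun r => LinearMap.toMatrix bil bij f r s) ⬝ᵥ normFormGram bij (qj / qi) *ᵥ
        fun r => LinearMap.toMatrix bil bij f r t : ℤ)) : ℚ) * (qj / qi) =
        (((n : ℤ) * normFormGram bil (ql / qi) s t : ℤ) : ℚ) * (qj / qi) := by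
      rw [h1, h2, ← hAil s t]
      push_cast
      rw [show reducedNorm ℚ S.D y * ((normFormGram bil (ql / qi) s t : ℚ) * (ql / qi)) =
          (normFormGram bil (ql / qi) s t : ℚ) * (reducedNorm ℚ S.D y * ql) / qi by ring, hn]
      ring
    exact_mod_cast mul_right_cancel₀ hne h4
  · -- `U V = n · 1`
    rw [← LinearMap.toMatrix_comp bij bil bij f g, hfg, map_zsmul, LinearMap.toMatrix_id]

/-- **H-g (size XS–S, elementary, PROVED).** A prime dividing the modulus `(c, N/(N,c))`, `N = N⁺N⁻`, `(N⁺,N⁻) = 1`, `N⁻` squarefree,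
satisfies `p² ∣ N⁺` and `p ∤ N⁻` (so B2 applies at it). [folklore] -/
theorem sq_dvd_and_not_dvd_of_dvd_gcd_level (hcop : Nplus.Coprime Nminus) (hsq : Squarefree Nminus) {c p : ℕ}
    (hp : p.Prime) (hpg : p ∣ Nat.gcd c ((Nplus * Nminus) / Nat.gcd (Nplus * Nminus) c)) :
    p ^ 2 ∣ Nplus ∧ ¬ p ∣ Nminus := by
  set N := Nplus * Nminus with hN
  set d := Nat.gcd N c with hd
  have hpc : p ∣ c := (Nat.dvd_gcd_iff.mp hpg).1
  have hpNd : p ∣ N / d := (Nat.dvd_gcd_iff.mp hpg).2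
  have hdN : d ∣ N := Nat.gcd_dvd_left N c
  have hpN : p ∣ N := hpNd.trans (Nat.div_dvd_of_dvd hdN)
  have hpd : p ∣ d := Nat.dvd_gcd hpN hpc
  have hp2N : p ^ 2 ∣ Nplus * Nminus :=
    calc p ^ 2 = p * p := sq p
      _ ∣ N / d * d := Nat.mul_dvd_mul hpNd hpd
      _ = N := Nat.div_mul_cancel hdN
  have hnot : ¬ p ∣ Nminus := by
    intro hpm
    have hpp : ¬ p ∣ Nplus := fun h =>
      hp.ne_one (Nat.Coprime.eq_one_of_dvd (Nat.Coprime.coprime_dvd_left h hcop) hpm)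
    have hcop2 : (p ^ 2).Coprime Nplus := Nat.Coprime.pow_left 2 ((Nat.Prime.coprime_iff_not_dvd hp).2 hpp)
    have h2m : p ^ 2 ∣ Nminus := hcop2.dvd_of_dvd_mul_left hp2N
    exact hp.ne_one (Nat.isUnit_iff.mp (hsq p (by simpa [sq] using h2m)))
  have hcop3 : (p ^ 2).Coprime Nminus := Nat.Coprime.pow_left 2 ((Nat.Prime.coprime_iff_not_dvd hp).2 hnot)
  exact ⟨hcop3.dvd_of_dvd_mul_right hp2N, hnot⟩

/-- **H-f (= B5a, size M, PROVED — the assembly of H-a, H-b, H-c, H-g with B2).** For classes `j, l` and `c ≥ 1` there is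
`y ∈ (I_j : I_l)_L` whose value `n = Q_{lj}(y) = nrd(y) q_l/q_j` is prime to `c` and `≡ 1 (mod (c, N/(N,c)))`:
local targets `x_p = q_l⁻¹ β_j^{(p)} z_p β̄_l^{(p)}` (`p ∣ c`; H-a at `p` for `β`'s, `z_p = 1` unless `p` divides the modulus,
where `z_p` comes from B2 with `nrd z_p ≡ (m_j m_l)⁻¹`), glued by H-c in the lattice `(I_j : I_l)_L` (a right ideal of
`O_L(I_l)`, setup `S.ofLeftOrder`). [cite: Voight2021, 41.1.3] [cite: VignerasLNM800, Ch. III §5] -/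
theorem exists_mem_transporterLeft_coprime_modEq (hcop : Nplus.Coprime Nminus) (hB2 : B2Statement S)
    (j l : ClassSet S.O) {c : ℕ} (hc : 0 < c) :
    ∃ y ∈ transporterLeft l.rep j.rep, ∃ n : ℕ,
      reducedNorm ℚ S.D y * S.nrdGen l.rep_mem = n * S.nrdGen j.rep_mem ∧ n.Coprime c ∧
        n ≡ 1 [MOD Nat.gcd c ((Nplus * Nminus) / Nat.gcd (Nplus * Nminus) c)] := by
  classical
  -- notation: `q_j`, `q_l`, the modulus `g`, the exponents `E p = v_p(g) + 1`
  set qj := S.nrdGen j.rep_mem with hqj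
  set ql := S.nrdGen l.rep_mem with hql
  have hqj0 : 0 < qj := S.nrdGen_pos j.rep_mem
  have hql0 : 0 < ql := S.nrdGen_pos l.rep_mem
  have hr0 : (0 : ℚ) < qj / ql := div_pos hqj0 hql0
  set g := Nat.gcd c ((Nplus * Nminus) / Nat.gcd (Nplus * Nminus) c) with hg
  have hg0 : g ≠ 0 := (Nat.gcd_pos_of_pos_left _ hc).ne'
  set E : ℕ → ℕ := fun p => g.factorization p + 1 with hE
  -- the lattice `Λ = (I_j : I_l)_L`, a right ideal of `O_L(I_l)` with `nrd(Λ) = ℤ q_j/q_l`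
  set S' := S.ofLeftOrder l.rep_mem with hS'
  have hΛ : transporterLeft l.rep j.rep ∈ rightIdeals S'.O :=
    S.transporterLeft_mem_rightIdeals_leftOrder l.rep_mem j.rep_mem
  have hnΛ : nrdIdeal (transporterLeft l.rep j.rep) = ℤ ∙ (qj / ql) :=
    S.nrdIdeal_transporterLeft j.rep_mem l.rep_mem hqj0 hql0 (S.nrdIdeal_eq_span_nrdGen j.rep_mem)
      (S.nrdIdeal_eq_span_nrdGen l.rep_mem)
  have hgen : S'.nrdGen hΛ = qj / ql := S'.nrdGen_eq hΛ hr0 hnΛ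
  -- the primes of `c`
  set P := c.primeFactors with hPdef
  have hPp : ∀ p ∈ P, p.Prime := fun p hp => (Nat.mem_primeFactors.mp hp).1
  -- H-a at each prime of `c`, for `I_j` and for `I_l`
  have keyj : ∀ p ∈ P, ∃ β ∈ j.rep, ∃ m : ℤ, reducedNorm ℚ S.D β = m * qj ∧ ¬ (p : ℤ) ∣ m :=
    fun p hp => exists_mem_reducedNorm_eq_mul_not_dvd S j.rep_mem (hPp p hp)
  choose! βj hβj mj hmj hpj using keyj
  have keyl : ∀ p ∈ P, ∃ β ∈ l.rep, ∃ m : ℤ, reducedNorm ℚ S.D β = m * ql ∧ ¬ (p : ℤ) ∣ m :=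
    fun p hp => exists_mem_reducedNorm_eq_mul_not_dvd S l.rep_mem (hPp p hp)
  choose! βl hβl ml hml hpl using keyl
  -- the local correctors `z_p ∈ O` (B2 at the primes of the modulus, `1` elsewhere)
  have keyz : ∀ p ∈ P, ∃ z ∈ S.O, ∃ nz : ℤ, reducedNorm ℚ S.D z = nz ∧ ¬ (p : ℤ) ∣ nz * (mj p * ml p) ∧
      (p ∣ g → (p : ℤ) ^ E p ∣ nz * (mj p * ml p) - 1) := by
    intro p hp
    have hpP := hPp p hp
    have hpint : Prime (p : ℤ) := Nat.prime_iff_prime_int.mp hpP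
    have hM : ¬ (p : ℤ) ∣ mj p * ml p := fun h => (hpint.dvd_or_dvd h).elim (hpj p hp) (hpl p hp)
    by_cases hpg : p ∣ g
    · have hpNm : ¬ p ∣ Nminus := (sq_dvd_and_not_dvd_of_dvd_gcd_level hcop S.squarefree hpP hpg).2
      have hcopM : IsCoprime ((p : ℤ) ^ E p) (mj p * ml p) :=
        ((Irreducible.coprime_iff_not_dvd hpint.irreducible).mpr hM).pow_left
      obtain ⟨u, v, huv⟩ := hcopM
      have hvp : IsCoprime v (p : ℤ) := by
        have h1 : IsCoprime v ((p : ℤ) ^ E p) := ⟨mj p * ml p, u, by linear_combination huv⟩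
        have h2 : (p : ℤ) ^ E p = (p : ℤ) ^ g.factorization p * p := pow_succ _ _
        rw [h2] at h1
        exact h1.of_mul_right_right
      obtain ⟨z, hz, nz, hnz, hdvd⟩ := hB2 p hpP hpNm (E p) v hvp
      have hmain : (p : ℤ) ^ E p ∣ nz * (mj p * ml p) - 1 := by
        have h3 : nz * (mj p * ml p) - 1 = (nz - v) * (mj p * ml p) - u * (p : ℤ) ^ E p := by
          linear_combination huv
        rw [h3]
        exact dvd_sub (hdvd.mul_right _) (dvd_mul_left _ _)
      refine ⟨z, hz, nz, hnz, fun h => ?_, fun _ => hmain⟩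
      have h4 : (p : ℤ) ∣ nz * (mj p * ml p) - 1 := (dvd_pow_self (p : ℤ) (Nat.succ_ne_zero _)).trans hmain
      have h5 : (p : ℤ) ∣ 1 := by
        have := dvd_sub h h4
        rwa [sub_sub_cancel] at this
      exact hpint.not_dvd_one h5
    · refine ⟨1, S.isEichlerOrder.isOrder.one_mem, 1, by rw [Int.cast_one]; exact reducedNorm_one ℚ S.D,
        by rwa [one_mul], fun h => (hpg h).elim⟩
  choose! z hz nz hnz hpz hgz using keyz
  -- the local targets `x_p = q_l⁻¹ β_j z_p β̄_l ∈ Λ`, `nrd x_p = (nz·m_j·m_l) · q_j/q_l`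
  set x : ℕ → S.D := fun p => algebraMap ℚ S.D ql⁻¹ * (βj p * z p * standardInvolution ℚ S.D (βl p)) with hx
  have hxΛ : ∀ p ∈ P, x p ∈ transporterLeft l.rep j.rep := fun p hp =>
    algebraMap_mul_mem_transporterLeft S j.rep_mem l.rep_mem (hβj p hp) (hz p hp) (hβl p hp)
  have hxn : ∀ p ∈ P, reducedNorm ℚ S.D (x p) = ((nz p * (mj p * ml p) : ℤ) : ℚ) * (qj / ql) := by
    intro p hp
    simp only [hx]
    rw [reducedNorm_algebraMap_mul, hmj p hp, hnz p hp, hml p hp]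
    push_cast
    field_simp
  -- ONE lattice CRT (H-c) in `Λ`
  obtain ⟨y, hy, hyc⟩ := exists_mem_forall_pow_dvd_reducedNorm_sub S' hΛ P hPp E x hxΛ
  have hyc' : ∀ p ∈ P, ∃ k : ℤ,
      reducedNorm ℚ S.D y - reducedNorm ℚ S.D (x p) = k * (p : ℚ) ^ E p * (qj / ql) := by
    intro p hp
    obtain ⟨k, hk⟩ := hyc p hp
    exact ⟨k, by rw [← hgen]; exact hk⟩
  -- `Q(y) = K ∈ ℤ_{≥ 0}`
  obtain ⟨K, hK⟩ := S.exists_int_reducedNorm_eq_mul hnΛ hy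
  have hK0 : 0 ≤ K := by
    have h0 : 0 ≤ reducedNorm ℚ S.D y := reducedNorm_nonneg_of_isTotallyDefinite _ S.isTotallyDefinite y
    rw [hK] at h0
    by_contra hneg
    push Not at hneg
    have : (K : ℚ) * (qj / ql) < 0 := mul_neg_of_neg_of_pos (by exact_mod_cast hneg) hr0
    linarith
  have hKA : ∀ p ∈ P, ∃ k : ℤ, K - nz p * (mj p * ml p) = k * (p : ℤ) ^ E p := by
    intro p hp
    obtain ⟨k, hk⟩ := hyc' p hp
    refine ⟨k, ?_⟩
    rw [hK, hxn p hp, ← sub_mul] at hk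
    have h1 := mul_right_cancel₀ hr0.ne' hk
    exact_mod_cast h1
  have hKn : ((K.toNat : ℕ) : ℤ) = K := Int.toNat_of_nonneg hK0
  refine ⟨y, hy, K.toNat, ?_, ?_, ?_⟩
  · have h1 : ((K.toNat : ℕ) : ℚ) = (K : ℚ) := by exact_mod_cast hKn
    rw [h1, hK]
    field_simp
  · refine Nat.coprime_of_dvd fun p hp hpK hpc => ?_
    have hpP : p ∈ P := Nat.mem_primeFactors.mpr ⟨hp, hpc, hc.ne'⟩
    obtain ⟨k, hk⟩ := hKA p hpP
    have h1 : (p : ℤ) ∣ K := by rw [← hKn]; exact Int.natCast_dvd_natCast.mpr hpK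
    have h2 : (p : ℤ) ∣ k * (p : ℤ) ^ E p := (dvd_pow_self (p : ℤ) (Nat.succ_ne_zero _)).mul_left _
    have h3 : (p : ℤ) ∣ nz p * (mj p * ml p) := by
      have := dvd_sub h1 h2
      rwa [← hk, sub_sub_cancel] at this
    exact hpz p hpP h3
  · -- `K ≡ 1 (mod g)`, prime power by prime power
    have hdiv : (g : ℤ) ∣ K - 1 := by
      rw [Int.natCast_dvd]
      refine (Nat.dvd_iff_prime_pow_dvd_dvd _ _).mpr fun p k hp hpk => ?_
      rcases Nat.eq_zero_or_pos k with rfl | hk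
      · simp
      have hkle : k ≤ g.factorization p := (hp.pow_dvd_iff_le_factorization hg0).mp hpk
      have hpg : p ∣ g := (dvd_pow_self p hk.ne').trans hpk
      have hpc : p ∣ c := hpg.trans (Nat.gcd_dvd_left _ _)
      have hpP : p ∈ P := Nat.mem_primeFactors.mpr ⟨hp, hpc, hc.ne'⟩
      obtain ⟨t, ht⟩ := hKA p hpP
      have h1 : (p : ℤ) ^ E p ∣ K - 1 := by
        have h2 : K - 1 = t * (p : ℤ) ^ E p + (nz p * (mj p * ml p) - 1) := by linear_combination ht
        rw [h2]
        exact dvd_add (dvd_mul_left _ _) (hgz p hpP hpg)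
      have h3 : ((p ^ k : ℕ) : ℤ) ∣ K - 1 := by
        push_cast
        exact (pow_dvd_pow (p : ℤ) (hkle.trans (Nat.le_succ _))).trans h1
      exact Int.natCast_dvd.mp h3
    rw [Nat.modEq_iff_dvd]
    push_cast [hKn]
    exact dvd_sub_comm.mp hdiv

/-! ## §2 Composition: B5 from H-f and H-e (kernel-checked) -/

/-- **B5 ⟸ (N⁺,N⁻)=1 + B2 (PROVED, via H-f + H-e).** With gen 7's B2, the tree's `XiSetup.coprime` and gen 8's
`brandtTheta_sub_isCuspForm_of_B5` this gives H1 unconditionally (`…_1_g9_H1complete.lean`). -/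
theorem b5Statement_of (hcop : Nplus.Coprime Nminus) (hB2 : B2Statement S) (i j l : ClassSet S.O) :
    B5Statement S i j l := by
  intro c hc
  obtain ⟨y, hy, n, hn, hnc, hmod⟩ := exists_mem_transporterLeft_coprime_modEq S hcop hB2 j l hc
  obtain ⟨U, V, hU, hV⟩ := exists_gram_datum_of_mem_transporterLeft S i j l hy hn
  exact ⟨n, hnc, hmod, U, V, hU, hV⟩

end Summit.ABC.ABC.Cruxes.SteinbergCore.StubIdeasK1G9

-- ════════ gen 8 (verbatim) ════════

namespace Summit.ABC.ABC.Cruxes.SteinbergCore.StubIdeasK1G8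

open Complex hiding I
open Matrix Filter Topology ModularForm
open Complex (I)
open scoped MatrixGroups UpperHalfPlane

open Literature.NumberTheory.ModularForms
open Literature.NumberTheory.ModularForms.SiegelModularForm (one1 one1_map one1_mul one1_inv smul_one1 det_one1
  one1_injective eq_one1 spOfSL spOfSL_mem moeb_spOfSL det_denom_spOfSL num_denom_spOfSL)
open Literature.NumberTheory.EllipticCurves.ModularForms
open Literature.NumberTheory.Automorphic Literature.NumberTheory.Automorphic.Brandt

/-! ## §0 Dictionary (gen 5/6) and the facts about `[T_ij]` the E-block consumes -/

variable {Nplus Nminus : ℕ} (S : XiSetup Nplus Nminus)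

/-- The Gram matrix `[T_{ij}]` behind `S.brandtTheta i j`. -/
def brandtGram (i j : ClassSet S.O) : Matrix (Fin 4) (Fin 4) ℤ :=
  normFormGram (S.nonempty_basis_transporterLeft i.rep_mem j.rep_mem).some (S.nrdGen j.rep_mem / S.nrdGen i.rep_mem)

theorem brandtTheta_apply (i j : ClassSet S.O) (τ : ℍ) :
    S.brandtTheta i j τ = siegelThetaSeries (brandtGram S i j) (one1 (τ : ℂ)) := rfl

/-- The Gram identity `⌊trd(b_r b̄_s)/q⌋ · q = trd(b_r b̄_s)` for the basis behind `brandtGram`. -/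
theorem cast_brandtGram_mul (i j : ClassSet S.O) (r s : Fin 4) :
    ((brandtGram S i j r s : ℤ) : ℚ) * (S.nrdGen j.rep_mem / S.nrdGen i.rep_mem) =
      reducedTrace ℚ S.D (((S.nonempty_basis_transporterLeft i.rep_mem j.rep_mem).some r : S.D) *
        standardInvolution ℚ S.D ((S.nonempty_basis_transporterLeft i.rep_mem j.rep_mem).some s : S.D)) :=
  (S.ofLeftOrder i.rep_mem).cast_normFormGram_mul (div_pos (S.nrdGen_pos j.rep_mem) (S.nrdGen_pos i.rep_mem)).ne'
    (S.nrdIdeal_transporterLeft j.rep_mem i.rep_mem (S.nrdGen_pos j.rep_mem) (S.nrdGen_pos i.rep_mem)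
      (S.nrdIdeal_eq_span_nrdGen j.rep_mem) (S.nrdIdeal_eq_span_nrdGen i.rep_mem)) _ r s

theorem det_brandtGram (i j : ClassSet S.O) : (brandtGram S i j).det = ((Nplus * Nminus : ℕ) : ℤ) ^ 2 :=
  (S.ofLeftOrder i.rep_mem).det_normFormGram (S.transporterLeft_mem_rightIdeals_leftOrder i.rep_mem j.rep_mem)
    (div_pos (S.nrdGen_pos j.rep_mem) (S.nrdGen_pos i.rep_mem))
    (S.nrdIdeal_transporterLeft j.rep_mem i.rep_mem (S.nrdGen_pos j.rep_mem) (S.nrdGen_pos i.rep_mem)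
      (S.nrdIdeal_eq_span_nrdGen j.rep_mem) (S.nrdIdeal_eq_span_nrdGen i.rep_mem)) (cast_brandtGram_mul S i j)

/-- NEW (proved). `[T_ij]` is symmetric. -/
theorem brandtGram_isSymm (i j : ClassSet S.O) : (brandtGram S i j).IsSymm :=
  isSymm_of_normFormGram (div_pos (S.nrdGen_pos j.rep_mem) (S.nrdGen_pos i.rep_mem)).ne' (cast_brandtGram_mul S i j)

/-- NEW (proved). `[T_ij]` is even. -/
theorem even_brandtGram_diag (i j : ClassSet S.O) (r : Fin 4) : Even (brandtGram S i j r r) :=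
  (S.ofLeftOrder i.rep_mem).even_normFormGram_diag (div_pos (S.nrdGen_pos j.rep_mem) (S.nrdGen_pos i.rep_mem)).ne'
    (S.nrdIdeal_transporterLeft j.rep_mem i.rep_mem (S.nrdGen_pos j.rep_mem) (S.nrdGen_pos i.rep_mem)
      (S.nrdIdeal_eq_span_nrdGen j.rep_mem) (S.nrdIdeal_eq_span_nrdGen i.rep_mem)) (cast_brandtGram_mul S i j) r

/-- NEW (proved). `[T_ij] > 0`. -/
theorem posDef_brandtGram (i j : ClassSet S.O) : ((brandtGram S i j).map ((↑) : ℤ → ℝ)).PosDef :=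
  (S.ofLeftOrder i.rep_mem).posDef_normFormGram_map (S.transporterLeft_mem_rightIdeals_leftOrder i.rep_mem j.rep_mem).1
    (div_pos (S.nrdGen_pos j.rep_mem) (S.nrdGen_pos i.rep_mem)) (cast_brandtGram_mul S i j)

/-- NEW (proved). The LEVEL DATUM of `[T_ij]`: `P·[T] = [T]·P = N⁺N⁻ · 1`, `P` even. -/
theorem exists_brandtGram_levelDatum (i j : ClassSet S.O) :
    ∃ P : Matrix (Fin 4) (Fin 4) ℤ, P * brandtGram S i j = ((Nplus * Nminus : ℕ) : ℤ) • (1 : Matrix (Fin 4) (Fin 4) ℤ) ∧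
      brandtGram S i j * P = ((Nplus * Nminus : ℕ) : ℤ) • (1 : Matrix (Fin 4) (Fin 4) ℤ) ∧ ∀ r, Even (P r r) :=
  (S.ofLeftOrder i.rep_mem).exists_normFormGram_levelDatum (S.transporterLeft_mem_rightIdeals_leftOrder i.rep_mem j.rep_mem)
    (div_pos (S.nrdGen_pos j.rep_mem) (S.nrdGen_pos i.rep_mem))
    (S.nrdIdeal_transporterLeft j.rep_mem i.rep_mem (S.nrdGen_pos j.rep_mem) (S.nrdGen_pos i.rep_mem)
      (S.nrdIdeal_eq_span_nrdGen j.rep_mem) (S.nrdIdeal_eq_span_nrdGen i.rep_mem)) (cast_brandtGram_mul S i j)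

/-- Cusp constant of `θ_Q ∣ γ` (gen 5, verbatim): `d^{m/2}` at `c = 0`, else `(√det Q)⁻¹ (ic)^{−m/2} |c|^m G(a/c, Q)`. -/
def thetaCuspValue {m : ℕ} (Q : Matrix (Fin m) (Fin m) ℤ) (γ : SL(2, ℤ)) : ℂ :=
  if γ 1 0 = 0 then ((γ 1 1 : ℤ) : ℂ) ^ (m / 2)
  else ((Real.sqrt ((Q.det : ℤ) : ℝ) : ℝ) : ℂ)⁻¹ * (I * ((γ 1 0 : ℤ) : ℂ)) ^ (-((m / 2 : ℕ) : ℤ)) *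
      (((γ 1 0).natAbs : ℕ) : ℂ) ^ m *
        siegelGaussSum Q (γ 1 0).natAbs (one1 (((γ 0 0 : ℤ) : ℂ) / ((γ 1 0 : ℤ) : ℂ)))

/-! ## §E0 The symplectic matrix `M = spOfSL (γ·S)` of the cusp path (all PROVED) -/

/-- Entries of `γ·S = (b, −a; d, −c)`. -/
theorem mul_S_apply (γ : SL(2, ℤ)) :
    (γ * ModularGroup.S) 0 0 = γ 0 1 ∧ (γ * ModularGroup.S) 0 1 = -(γ 0 0) ∧
      (γ * ModularGroup.S) 1 0 = γ 1 1 ∧ (γ * ModularGroup.S) 1 1 = -(γ 1 0) := by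
  refine ⟨?_, ?_, ?_, ?_⟩ <;>
    simp [Matrix.SpecialLinearGroup.coe_mul, ModularGroup.coe_S, Matrix.mul_apply, Fin.sum_univ_two]

/-- Blocks of `M = spOfSL (γ·S)`: `B = (−a)`, `C = (d)`, `D = (−c)`. -/
theorem toBlocks_spOfSL_mul_S (γ : SL(2, ℤ)) :
    (spOfSL (γ * ModularGroup.S)).toBlocks₁₂ = one1 (-(γ 0 0)) ∧ (spOfSL (γ * ModularGroup.S)).toBlocks₂₁ = one1 (γ 1 1) ∧
      (spOfSL (γ * ModularGroup.S)).toBlocks₂₂ = one1 (-(γ 1 0)) := by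
  obtain ⟨-, h01, h10, h11⟩ := mul_S_apply γ
  refine ⟨?_, ?_, ?_⟩
  · rw [spOfSL, Matrix.toBlocks_fromBlocks₁₂, h01]
  · rw [spOfSL, Matrix.toBlocks_fromBlocks₂₁, h10]
  · rw [spOfSL, Matrix.toBlocks_fromBlocks₂₂, h11]

/-- `det D = −c ≠ 0` off the cusp `∞`. -/
theorem det_toBlocks₂₂_spOfSL_mul_S (γ : SL(2, ℤ)) : (spOfSL (γ * ModularGroup.S)).toBlocks₂₂.det = -(γ 1 0) := by
  rw [(toBlocks_spOfSL_mul_S γ).2.2, det_one1]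

/-- `d·BD⁻¹ = (a·sign c)` is integral for `d = |c|`. -/
theorem natAbs_smul_B_mul_inv_D (γ : SL(2, ℤ)) (hc : γ 1 0 ≠ 0) :
    (((γ 1 0).natAbs : ℕ) : ℂ) • ((spOfSL (γ * ModularGroup.S)).toBlocks₁₂.map ((↑) : ℤ → ℂ) *
        ((spOfSL (γ * ModularGroup.S)).toBlocks₂₂.map ((↑) : ℤ → ℂ))⁻¹) =
      (one1 (γ 0 0 * Int.sign (γ 1 0))).map ((↑) : ℤ → ℂ) := by
  obtain ⟨h12, -, h22⟩ := toBlocks_spOfSL_mul_S γ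
  have hc' : ((-(γ 1 0) : ℤ) : ℂ) ≠ 0 := by exact_mod_cast (neg_ne_zero.2 hc)
  rw [h12, h22, one1_map, one1_map, one1_inv hc', one1_mul, smul_one1, one1_map]
  congr 1
  have habs : (((γ 1 0).natAbs : ℕ) : ℂ) = ((Int.sign (γ 1 0) * γ 1 0 : ℤ) : ℂ) := by
    rw [Int.sign_mul_self_eq_natAbs, Int.cast_natCast]
  have hc0 : ((γ 1 0 : ℤ) : ℂ) ≠ 0 := by exact_mod_cast hc
  rw [habs]
  push_cast
  field_simp

/-- `BD⁻¹ = (a/c)` for `M = spOfSL (γ·S)`. -/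
theorem B_mul_inv_D_eq (γ : SL(2, ℤ)) (hc : γ 1 0 ≠ 0) :
    (spOfSL (γ * ModularGroup.S)).toBlocks₁₂.map ((↑) : ℤ → ℂ) * ((spOfSL (γ * ModularGroup.S)).toBlocks₂₂.map ((↑) : ℤ → ℂ))⁻¹ =
      one1 (((γ 0 0 : ℤ) : ℂ) / ((γ 1 0 : ℤ) : ℂ)) := by
  obtain ⟨h12, -, h22⟩ := toBlocks_spOfSL_mul_S γ
  have hc' : ((-(γ 1 0) : ℤ) : ℂ) ≠ 0 := by exact_mod_cast (neg_ne_zero.2 hc)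
  rw [h12, h22, one1_map, one1_map, one1_inv hc', one1_mul]
  congr 1
  push_cast
  rw [neg_mul, inv_neg, mul_neg, neg_neg, div_eq_mul_inv]

/-- The cusp path in Siegel coordinates: `M⟨it·1⟩ = ((γ·S)·(it)) = (γ·(i/t))`. -/
theorem moeb_spOfSL_mul_S_I_smul (γ : SL(2, ℤ)) {t : ℝ} (ht : 0 < t) :
    SiegelUpperHalfSpace.moeb ((spOfSL (γ * ModularGroup.S)).map ((↑) : ℤ → ℂ)) ((I * (t : ℂ)) • (1 : Matrix (Fin 1) (Fin 1) ℂ)) =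
      one1 (((γ • (ModularGroup.S • UpperHalfPlane.ofComplex (I * t)) : ℍ) : ℂ)) := by
  have hIm : 0 < (I * t : ℂ).im := by simp [ht]
  have h1 : (I * (t : ℂ)) • (1 : Matrix (Fin 1) (Fin 1) ℂ) = one1 (((UpperHalfPlane.ofComplex (I * t) : ℍ) : ℂ)) := by
    rw [UpperHalfPlane.ofComplex_apply_of_im_pos hIm, ← SiegelModularForm.one1_one, smul_one1, mul_one]
  rw [h1, moeb_spOfSL, mul_smul]

/-- `det(C·(it) + D) = c_δ·it + d_δ` for `M = spOfSL δ` at `Z = it·1`. -/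
theorem det_denom_spOfSL_I_smul (δ : SL(2, ℤ)) {t : ℝ} (ht : 0 < t) :
    (SiegelUpperHalfSpace.denom ((spOfSL δ).map ((↑) : ℤ → ℂ)) ((I * (t : ℂ)) • (1 : Matrix (Fin 1) (Fin 1) ℂ))).det =
      ((δ 1 0 : ℤ) : ℂ) * (I * t) + ((δ 1 1 : ℤ) : ℂ) := by
  have hIm : 0 < (I * t : ℂ).im := by simp [ht]
  have h1 : (I * (t : ℂ)) • (1 : Matrix (Fin 1) (Fin 1) ℂ) = one1 (((UpperHalfPlane.ofComplex (I * t) : ℍ) : ℂ)) := by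
    rw [UpperHalfPlane.ofComplex_apply_of_im_pos hIm, ← SiegelModularForm.one1_one, smul_one1, mul_one]
  rw [h1, det_denom_spOfSL, ModularGroup.denom_apply, UpperHalfPlane.ofComplex_apply_of_im_pos hIm]

/-- The path `t ↦ S·(it) = i/t` runs into the cusp `i∞` as `t → 0⁺`. -/
theorem tendsto_S_smul_ofComplex_I_mul :
    Tendsto (fun t : ℝ => ModularGroup.S • UpperHalfPlane.ofComplex (I * t)) (𝓝[>] 0) UpperHalfPlane.atImInfty := by
  rw [UpperHalfPlane.atImInfty, Filter.tendsto_comap_iff]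
  refine tendsto_inv_nhdsGT_zero.congr' (eventually_nhdsWithin_of_forall fun t (ht : 0 < t) => ?_)
  have hIm : 0 < (I * t : ℂ).im := by simp [ht]
  rw [Function.comp_apply, UpperHalfPlane.modular_S_smul, UpperHalfPlane.im, UpperHalfPlane.coe_mk,
    UpperHalfPlane.ofComplex_apply_of_im_pos hIm]
  simp [Complex.inv_im, Complex.normSq_apply]

/-- The scalar identity behind E1: `t²(ci + d t)^{−2} · (t⁻¹ c⁻² (d·it − c)(−c))² = −c⁻²` (through
`d·it − c = it·(c(−it)⁻¹ + d)` and `I² = −1`). PROVED. -/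
theorem cuspPath_scalar (s c d t : ℂ) (hs : s ≠ 0) (hc : c ≠ 0) (ht : t ≠ 0) (hx : c * (-(I * t))⁻¹ + d ≠ 0) :
    s⁻¹ * (t⁻¹ * (c ^ 2)⁻¹ * (d * (I * t) + -c) * -c) ^ 2 * ((c * (-(I * t))⁻¹ + d) ^ 2)⁻¹ = -(s⁻¹ * (c ^ 2)⁻¹) := by
  have hIt : -(I * t) ≠ 0 := neg_ne_zero.2 (mul_ne_zero I_ne_zero ht)
  have hy : d * (I * t) + -c = I * t * (c * (-(I * t))⁻¹ + d) := by
    field_simp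
    ring
  rw [hy]
  generalize c * (-(I * t))⁻¹ + d = x at hx ⊢
  have hI : (I * t * x) ^ 2 = -(t ^ 2 * x ^ 2) := by
    rw [mul_pow, mul_pow, I_sq]; ring
  rw [show (t⁻¹ * (c ^ 2)⁻¹ * (I * t * x) * -c) ^ 2 = (t⁻¹ * (c ^ 2)⁻¹ * -c) ^ 2 * (I * t * x) ^ 2 by ring, hI]
  field_simp

/-! ## §E The analytic spine E1 → E1b → E1′ (ALL PROVED, gen 8) -/

/-- **E1 (PROVED, gen 8).** `(Θ_ij ∣₂ γ)(S·it) = −(√det[T])⁻¹ c⁻² Σ_{L : Fin 4 → Fin |c|} e{[T][L]·a/c}·Θ_P(Z′_t, W_L)`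
for `c = γ₁₀ ≠ 0`, `t > 0`, `P` the level datum.  PROOF ROUTE: `ModularForm.SL_slash_apply`, `brandtTheta_apply`,
`moeb_spOfSL_mul_S_I_smul` (backwards) to reach `siegelThetaSeries [T] (M⟨it·1⟩)`; then
`siegelThetaSeries_moeb_I_smul_eq_sum [T] (brandtGram_isSymm) (even_brandtGram_diag) (posDef_brandtGram) ⟨2, rfl⟩ hN hPQ hQP
(spOfSL_mem _) (det_toBlocks₂₂_spOfSL_mul_S ▸ …) (Int.natAbs_pos.2 hc) (natAbs_smul_B_mul_inv_D γ hc) ht` (n = 1, so `(…)^n`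
is `(…)^1`), `B_mul_inv_D_eq` under `Finset.sum_congr`; the scalar algebra: `denom(γ, S·it) = (ci + d_γ t)/t`
(`ModularGroup.denom_apply`, `modular_S_smul`), `det (denom M (it·1)) = d_γ·it − c = i(ci + d_γ t)` (`denom_fromBlocks`,
`det_one1`), `det D = −c`, whence `t²(ci+d_γ t)^{−2} · (t⁻¹ c⁻² (d_γ it − c)(−c))² = −c⁻²` (`field_simp; ring` with `I_sq`). -/
theorem slash_brandtTheta_apply_cuspPath [NeZero (Nplus * Nminus)] (i j : ClassSet S.O) (γ : SL(2, ℤ)) (hc : γ 1 0 ≠ 0)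
    {P : Matrix (Fin 4) (Fin 4) ℤ} (hPQ : P * brandtGram S i j = ((Nplus * Nminus : ℕ) : ℤ) • (1 : Matrix (Fin 4) (Fin 4) ℤ))
    (hQP : brandtGram S i j * P = ((Nplus * Nminus : ℕ) : ℤ) • (1 : Matrix (Fin 4) (Fin 4) ℤ)) {t : ℝ} (ht : 0 < t) :
    (⇑(S.brandtTheta i j) ∣[(2 : ℤ)] (γ : GL (Fin 2) ℝ)) (ModularGroup.S • UpperHalfPlane.ofComplex (I * t)) =
      -((((Real.sqrt ((brandtGram S i j).map ((↑) : ℤ → ℝ)).det : ℝ) : ℂ))⁻¹ * (((γ 1 0 : ℤ) : ℂ) ^ 2)⁻¹) *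
        ∑ L : Matrix (Fin 4) (Fin 1) (Fin (γ 1 0).natAbs),
          siegelThetaSeriesTerm (brandtGram S i j) (one1 (((γ 0 0 : ℤ) : ℂ) / ((γ 1 0 : ℤ) : ℂ))) (L.map fun x => ((x : ℕ) : ℤ)) *
            siegelJacobiTheta P (0 : Matrix (Fin 1) (Fin 4) ℂ)
              ((((Nplus * Nminus : ℕ) : ℤ) : ℂ)⁻¹ • ((-((I * (t : ℂ))⁻¹ * ((((γ 1 0).natAbs : ℕ) : ℂ) ^ 2)⁻¹)) •
                (SiegelUpperHalfSpace.denom ((spOfSL (γ * ModularGroup.S)).map ((↑) : ℤ → ℂ))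
                    ((I * (t : ℂ)) • (1 : Matrix (Fin 1) (Fin 1) ℂ)) *
                  ((spOfSL (γ * ModularGroup.S)).toBlocks₂₂.map ((↑) : ℤ → ℂ))ᵀ)))
              ((((Nplus * Nminus : ℕ) : ℤ) : ℂ)⁻¹ •
                (((((γ 1 0).natAbs : ℕ) : ℂ))⁻¹ • ((L.map fun x => ((x : ℕ) : ℤ)).map ((↑) : ℤ → ℂ))ᵀ *
                  (brandtGram S i j).map ((↑) : ℤ → ℂ))) := by
  set Q := brandtGram S i j with hQdef
  have hQ := brandtGram_isSymm S i j
  have hQe := even_brandtGram_diag S i j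
  have hQp := posDef_brandtGram S i j
  have hN : (0 : ℤ) < ((Nplus * Nminus : ℕ) : ℤ) := by exact_mod_cast Nat.pos_of_ne_zero (NeZero.ne (Nplus * Nminus))
  have hM := spOfSL_mem (γ * ModularGroup.S)
  have hD : (spOfSL (γ * ModularGroup.S)).toBlocks₂₂.det ≠ 0 := by
    rw [det_toBlocks₂₂_spOfSL_mul_S]; exact neg_ne_zero.2 hc
  have hd : 0 < (γ 1 0).natAbs := Int.natAbs_pos.2 hc
  have hdS := natAbs_smul_B_mul_inv_D γ hc
  have hIm : 0 < (I * t : ℂ).im := by simp [ht]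
  -- the point `S·(it) = (−it)⁻¹` and the automorphy factor `c(−it)⁻¹ + d ≠ 0`
  have hcoe : ((ModularGroup.S • UpperHalfPlane.ofComplex (I * t) : ℍ) : ℂ) = (-(I * t))⁻¹ := by
    rw [UpperHalfPlane.modular_S_smul, UpperHalfPlane.coe_mk, UpperHalfPlane.ofComplex_apply_of_im_pos hIm]
  have hx := UpperHalfPlane.denom_ne_zero (γ : GL (Fin 2) ℝ) (ModularGroup.S • UpperHalfPlane.ofComplex (I * t))
  rw [ModularGroup.denom_apply, hcoe] at hx
  -- expand along (4.13)–(4.14)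
  rw [← ModularForm.SL_slash, ModularForm.SL_slash_apply, ModularGroup.denom_apply, hcoe, brandtTheta_apply, ← hQdef,
    ← moeb_spOfSL_mul_S_I_smul γ ht,
    siegelThetaSeries_moeb_I_smul_eq_sum Q hQ hQe hQp ⟨2, rfl⟩ hN hPQ hQP hM hD hd hdS ht]
  simp only [B_mul_inv_D_eq γ hc]
  rw [det_denom_spOfSL_I_smul (γ * ModularGroup.S) ht, det_toBlocks₂₂_spOfSL_mul_S, (mul_S_apply γ).2.2.1,
    (mul_S_apply γ).2.2.2]
  -- scalar algebra: `t²(ci + d_γ t)^{−2} · (t⁻¹ c⁻² (d_γ it − c)(−c))² = −c⁻²`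
  have ht0 : (t : ℂ) ≠ 0 := by exact_mod_cast ht.ne'
  have hc0 : ((γ 1 0 : ℤ) : ℂ) ≠ 0 := by exact_mod_cast hc
  have hd0 : (((γ 1 0).natAbs : ℕ) : ℂ) ≠ 0 := by exact_mod_cast hd.ne'
  have hd2 : (((γ 1 0).natAbs : ℕ) : ℂ) ^ 2 = ((γ 1 0 : ℤ) : ℂ) ^ 2 := by
    rw [← Int.cast_natCast, ← Int.cast_pow, Int.natAbs_sq, Int.cast_pow]
  have hs : ((Real.sqrt (Q.map ((↑) : ℤ → ℝ)).det : ℝ) : ℂ) ≠ 0 := by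
    exact_mod_cast (Real.sqrt_pos.2 hQp.det_pos).ne'
  have hIt : (-(I * (t : ℂ))) ≠ 0 := neg_ne_zero.2 (mul_ne_zero I_ne_zero ht0)
  rw [show (4 / 2 : ℕ) = 2 from rfl, _root_.zpow_neg, zpow_ofNat, mul_right_comm]
  congr 1
  simp only [pow_one]
  push_cast
  rw [hd2]
  linear_combination cuspPath_scalar _ _ ((γ 1 1 : ℤ) : ℂ) _ hs hc0 ht0 hx

/-- **E1b (PROVED, gen 8).** The limit along the path is the gen-5 cusp constant:
`(Θ_ij ∣₂ γ)(S·it) → thetaCuspValue [T_ij] γ` as `t → 0⁺` (`c ≠ 0`).  PROOF ROUTE: `Tendsto.congr'` with E1 on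
`𝓝[>] 0`; `tendsto_finset_sum` and, termwise, `tendsto_siegelJacobiTheta_zPrime P hP hPp hD hd hN W` with the REAL matrix
`W = N⁻¹|c|⁻¹ ᵗL [T]` (`Matrix.map` bookkeeping: `W.map ofReal = …`; `hP`, `hPp` from `isSymm_of_level₅`/`posDef_map_of_level`
as in the tree's proof of `siegelThetaChi_eq_pow_mul_siegelGaussSum`); the value: `Σ_L e{[T][L]a/c} = |c|⁴ · siegelGaussSum [T] |c| (a/c)`
(`siegelGaussSum_def`, `4 * 1 = 4`), `(I c)^{−2} = −(c²)⁻¹` (`I_sq`), `√det([T]ℝ) = √((det[T] : ℤ) : ℝ)` (`Int.cast_det` /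
`RingHom.map_det`), `thetaCuspValue, if_neg hc`. -/
theorem tendsto_slash_brandtTheta_cuspPath [NeZero (Nplus * Nminus)] (i j : ClassSet S.O) (γ : SL(2, ℤ)) (hc : γ 1 0 ≠ 0) :
    Tendsto (fun t : ℝ => (⇑(S.brandtTheta i j) ∣[(2 : ℤ)] (γ : GL (Fin 2) ℝ)) (ModularGroup.S • UpperHalfPlane.ofComplex (I * t)))
      (𝓝[>] 0) (𝓝 (thetaCuspValue (brandtGram S i j) γ)) := by
  obtain ⟨P, hPQ, hQP, -⟩ := exists_brandtGram_levelDatum S i j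
  have hQ := brandtGram_isSymm S i j
  have hQp := posDef_brandtGram S i j
  set Q := brandtGram S i j with hQdef
  have hN : (0 : ℤ) < ((Nplus * Nminus : ℕ) : ℤ) := by exact_mod_cast Nat.pos_of_ne_zero (NeZero.ne (Nplus * Nminus))
  -- `P = N[T]⁻¹` is symmetric and positive
  have hP : P.IsSymm := by
    have h1 : Pᵀ * Q = P * Q := by
      rw [hPQ, ← hQ.eq, ← Matrix.transpose_mul, hQP, Matrix.transpose_smul, Matrix.transpose_one]
    have h2 : ((Nplus * Nminus : ℕ) : ℤ) • Pᵀ = ((Nplus * Nminus : ℕ) : ℤ) • P := by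
      calc ((Nplus * Nminus : ℕ) : ℤ) • Pᵀ = Pᵀ * (Q * P) := by rw [hQP, Matrix.mul_smul, Matrix.mul_one]
        _ = P * (Q * P) := by rw [← Matrix.mul_assoc, h1, Matrix.mul_assoc]
        _ = ((Nplus * Nminus : ℕ) : ℤ) • P := by rw [hQP, Matrix.mul_smul, Matrix.mul_one]
    refine Matrix.IsSymm.ext fun a b => mul_left_cancel₀ hN.ne' ?_
    have h := congr_fun (congr_fun h2 a) b
    simpa only [Matrix.smul_apply, Matrix.transpose_apply, smul_eq_mul] using h
  have hPp : (P.map ((↑) : ℤ → ℝ)).PosDef := posDef_map_of_level Q hQp hN hQP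
  have hD : (spOfSL (γ * ModularGroup.S)).toBlocks₂₂.det ≠ 0 := by
    rw [det_toBlocks₂₂_spOfSL_mul_S]; exact neg_ne_zero.2 hc
  have hd : 0 < (γ 1 0).natAbs := Int.natAbs_pos.2 hc
  -- termwise: every theta factor `Θ_P(Z′_t, W_L) → 1` (A–Z: "we can take the limit term by term … equal to 1")
  have hterm : ∀ L : Matrix (Fin 4) (Fin 1) (Fin (γ 1 0).natAbs),
      Tendsto (fun t : ℝ => siegelJacobiTheta P (0 : Matrix (Fin 1) (Fin 4) ℂ)
        ((((Nplus * Nminus : ℕ) : ℤ) : ℂ)⁻¹ • ((-((I * (t : ℂ))⁻¹ * ((((γ 1 0).natAbs : ℕ) : ℂ) ^ 2)⁻¹)) •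
          (SiegelUpperHalfSpace.denom ((spOfSL (γ * ModularGroup.S)).map ((↑) : ℤ → ℂ))
              ((I * (t : ℂ)) • (1 : Matrix (Fin 1) (Fin 1) ℂ)) *
            ((spOfSL (γ * ModularGroup.S)).toBlocks₂₂.map ((↑) : ℤ → ℂ))ᵀ)))
        ((((Nplus * Nminus : ℕ) : ℤ) : ℂ)⁻¹ •
          (((((γ 1 0).natAbs : ℕ) : ℂ))⁻¹ • ((L.map fun x => ((x : ℕ) : ℤ)).map ((↑) : ℤ → ℂ))ᵀ * Q.map ((↑) : ℤ → ℂ))))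
        (𝓝[>] 0) (𝓝 1) := by
    intro L
    have h := tendsto_siegelJacobiTheta_zPrime hP hPp hD hd hN
      ((((Nplus * Nminus : ℕ) : ℤ) : ℝ)⁻¹ •
        (((((γ 1 0).natAbs : ℕ) : ℝ))⁻¹ • ((L.map fun x => ((x : ℕ) : ℤ)).map ((↑) : ℤ → ℝ))ᵀ * Q.map ((↑) : ℤ → ℝ)))
    have hW : ((((Nplus * Nminus : ℕ) : ℤ) : ℝ)⁻¹ •
        (((((γ 1 0).natAbs : ℕ) : ℝ))⁻¹ • ((L.map fun x => ((x : ℕ) : ℤ)).map ((↑) : ℤ → ℝ))ᵀ * Q.map ((↑) : ℤ → ℝ))).map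
          ((↑) : ℝ → ℂ) =
        (((Nplus * Nminus : ℕ) : ℤ) : ℂ)⁻¹ •
          (((((γ 1 0).natAbs : ℕ) : ℂ))⁻¹ • ((L.map fun x => ((x : ℕ) : ℤ)).map ((↑) : ℤ → ℂ))ᵀ * Q.map ((↑) : ℤ → ℂ)) := by
      ext a b
      simp [Matrix.map_apply, Matrix.mul_apply, Matrix.smul_apply, Matrix.transpose_apply, Complex.ofReal_mul,
        Complex.ofReal_inv, Finset.mul_sum, -Nat.cast_natAbs]
    rw [hW] at h
    exact h
  -- E1 along the filter, the finite sum of limits, and the value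
  have hE : ∀ᶠ t : ℝ in 𝓝[>] 0, _ = _ :=
    eventually_nhdsWithin_of_forall fun t (ht : 0 < t) => slash_brandtTheta_apply_cuspPath S i j γ hc hPQ hQP ht
  have hsum := (tendsto_finsetSum Finset.univ fun L _ =>
    (hterm L).const_mul (siegelThetaSeriesTerm Q (one1 (((γ 0 0 : ℤ) : ℂ) / ((γ 1 0 : ℤ) : ℂ))) (L.map fun x => ((x : ℕ) : ℤ)))).const_mul
      (-((((Real.sqrt (Q.map ((↑) : ℤ → ℝ)).det : ℝ) : ℂ))⁻¹ * (((γ 1 0 : ℤ) : ℂ) ^ 2)⁻¹))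
  have hdet : ((Q.map ((↑) : ℤ → ℝ)).det : ℝ) = ((Q.det : ℤ) : ℝ) := by
    rw [show Q.map ((↑) : ℤ → ℝ) = (Int.castRingHom ℝ).mapMatrix Q from rfl, ← RingHom.map_det, eq_intCast]
  have hc0 : ((γ 1 0 : ℤ) : ℂ) ≠ 0 := by exact_mod_cast hc
  have hd0 : (((γ 1 0).natAbs : ℕ) : ℂ) ≠ 0 := by exact_mod_cast hd.ne'
  have hv : -((((Real.sqrt (Q.map ((↑) : ℤ → ℝ)).det : ℝ) : ℂ))⁻¹ * (((γ 1 0 : ℤ) : ℂ) ^ 2)⁻¹) *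
      ∑ L : Matrix (Fin 4) (Fin 1) (Fin (γ 1 0).natAbs),
        siegelThetaSeriesTerm Q (one1 (((γ 0 0 : ℤ) : ℂ) / ((γ 1 0 : ℤ) : ℂ))) (L.map fun x => ((x : ℕ) : ℤ)) * 1 =
      thetaCuspValue Q γ := by
    rw [thetaCuspValue, if_neg hc, siegelGaussSum_def, hdet]
    simp only [mul_one]
    rw [show (-((4 / 2 : ℕ) : ℤ)) = -(2 : ℤ) by norm_num, _root_.zpow_neg, zpow_ofNat, mul_pow, I_sq]
    field_simp
  rw [hv] at hsum
  exact hsum.congr' (hE.mono fun t ht => ht.symm)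

/-- Every `SL₂(ℤ)`-translate of `Θ_ij` tends to its `valueAtInfty` at `i∞` (tree `tendsto_cosetSlash`; as in gen-5 L1). PROVED. -/
theorem tendsto_slash_brandtTheta_atImInfty [NeZero (Nplus * Nminus)] (i j : ClassSet S.O) (γ : SL(2, ℤ)) :
    Tendsto (⇑(S.brandtTheta i j) ∣[(2 : ℤ)] (γ : GL (Fin 2) ℝ)) UpperHalfPlane.atImInfty
      (𝓝 (UpperHalfPlane.valueAtInfty (⇑(S.brandtTheta i j) ∣[(2 : ℤ)] (γ : GL (Fin 2) ℝ)))) := by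
  have := tendsto_cosetSlash (coe_mem_formSpace (S.brandtTheta i j))
    ((γ⁻¹ : SL(2, ℤ)) : SL(2, ℤ) ⧸ CongruenceSubgroup.Gamma0 (Nplus * Nminus))
  rwa [cosetSlash_mk (slash_eq_of_mem_gamma0Space (coe_mem_formSpace (S.brandtTheta i j))), inv_inv] at this

/-- **E1c (c = 0, PROVED).** At the cusp `∞` itself: `γ = ±T^h ∈ Γ₀(N)`, so `v(Θ_ij ∣₂ γ) = v(Θ_ij) = 1 = d²`. -/
theorem valueAtInfty_slash_brandtTheta_of_apply_eq_zero [NeZero (Nplus * Nminus)] (i j : ClassSet S.O) (γ : SL(2, ℤ))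
    (hc : γ 1 0 = 0) :
    UpperHalfPlane.valueAtInfty (⇑(S.brandtTheta i j) ∣[(2 : ℤ)] (γ : GL (Fin 2) ℝ)) = thetaCuspValue (brandtGram S i j) γ := by
  have hγ : γ ∈ CongruenceSubgroup.Gamma0 (Nplus * Nminus) := by
    rw [CongruenceSubgroup.Gamma0_mem, hc, Int.cast_zero]
  rw [slash_eq_of_mem_gamma0Space (coe_mem_formSpace (S.brandtTheta i j)) γ hγ, S.valueAtInfty_brandtTheta,
    thetaCuspValue, if_pos hc]
  have hdet := Matrix.det_fin_two (γ : Matrix (Fin 2) (Fin 2) ℤ)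
  rw [γ.det_coe, hc, mul_zero, sub_zero] at hdet
  rcases Int.eq_one_or_neg_one_of_mul_eq_one' hdet.symm with ⟨-, h⟩ | ⟨-, h⟩ <;> rw [h] <;> norm_num

/-- **E1′ (PROVED from E1b).** `valueAtInfty (Θ_ij ∣₂ γ) = thetaCuspValue [T_ij] γ` for every `γ ∈ SL₂(ℤ)`:
`c = 0` is E1c; `c ≠ 0` is uniqueness of limits along the path `S·(it) → i∞` between E1b and
`tendsto_slash_brandtTheta_atImInfty`. This is the E1′ the gen-6 composition `brandtTheta_sub_isCuspForm` consumes. -/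
theorem valueAtInfty_slash_brandtTheta [NeZero (Nplus * Nminus)] (i j : ClassSet S.O) (γ : SL(2, ℤ)) :
    UpperHalfPlane.valueAtInfty (⇑(S.brandtTheta i j) ∣[(2 : ℤ)] (γ : GL (Fin 2) ℝ)) = thetaCuspValue (brandtGram S i j) γ := by
  by_cases hc : γ 1 0 = 0
  · exact valueAtInfty_slash_brandtTheta_of_apply_eq_zero S i j γ hc
  · exact tendsto_nhds_unique ((tendsto_slash_brandtTheta_atImInfty S i j γ).comp tendsto_S_smul_ofComplex_I_mul)
      (tendsto_slash_brandtTheta_cuspPath S i j γ hc)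

/-! ## §F One cheap arithmetic helper of the gen-6 block: C3b (PROVED, gen 8) -/

/-- **C3b (gen 6, PROVED gen 8).** `G(a/c, Q)` depends only on `a mod c` for even symmetric `Q`: by
`siegelGaussSum_fin_one_eq_sum_stdAddChar` (A–Z (4.10), Prop. 4.9) it is `|c|^{-m} Σ_L ψ_{|c|}(a·sgn c·Q[L]/2)`, and
`a ≡ a' (mod |c|)` in `ZMod |c|` (`ZMod.intCast_eq_intCast_iff`). -/
theorem siegelGaussSum_congr_num {m : ℕ} {Q : Matrix (Fin m) (Fin m) ℤ} (hQ : Q.IsSymm) (hQe : ∀ i, Even (Q i i))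
    {a a' c : ℤ} (hc : c ≠ 0) (h : a ≡ a' [ZMOD c]) :
    siegelGaussSum Q c.natAbs (one1 ((a : ℂ) / (c : ℂ))) = siegelGaussSum Q c.natAbs (one1 ((a' : ℂ) / (c : ℂ))) := by
  haveI : NeZero c.natAbs := ⟨Int.natAbs_ne_zero.2 hc⟩
  have h' : a ≡ a' [ZMOD (c.natAbs : ℤ)] := Int.modEq_iff_dvd.2 (Int.natAbs_dvd.2 (Int.modEq_iff_dvd.1 h))
  show siegelGaussSum Q _ (Matrix.of fun _ _ : Fin 1 => _) = siegelGaussSum Q _ (Matrix.of fun _ _ : Fin 1 => _)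
  rw [siegelGaussSum_fin_one_eq_sum_stdAddChar Q hQ hQe rfl a, siegelGaussSum_fin_one_eq_sum_stdAddChar Q hQ hQe rfl a']
  congr 1
  refine Finset.sum_congr rfl fun L _ => ?_
  congr 1
  exact (ZMod.intCast_eq_intCast_iff _ _ _).2 ((h'.mul_right _).mul_right _)

/-! ## §G E2′ — the exact-conjugation case of the gen-6 helper E2 (the only case C4 uses; PROVED gen 8) -/

theorem map_mul_intCast {R : Type*} [NonAssocRing R] {a b c : Type*} [Fintype b] (A : Matrix a b ℤ) (B : Matrix b c ℤ) :
    (A * B).map ((↑) : ℤ → R) = A.map ((↑) : ℤ → R) * B.map ((↑) : ℤ → R) :=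
  Matrix.map_mul (f := Int.castRingHom R)

/-- `e{Q[U][L]·S} = e{Q[UL]·S}`. -/
theorem siegelThetaSeriesTerm_conj {m n : ℕ} (Q U : Matrix (Fin m) (Fin m) ℤ) (S' : Matrix (Fin n) (Fin n) ℂ)
    (L : Matrix (Fin m) (Fin n) ℤ) :
    siegelThetaSeriesTerm (Uᵀ * Q * U) S' L = siegelThetaSeriesTerm Q S' (U * L) := by
  rw [siegelThetaSeriesTerm_def, siegelThetaSeriesTerm_def, map_mul_intCast, map_mul_intCast, map_mul_intCast,
    Matrix.transpose_map, Matrix.transpose_mul]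
  simp only [Matrix.mul_assoc]

/-- **E2′ (gen 8, PROVED).** `G_d(S, Q[U]) = G_d(S, Q)` for `U` invertible modulo `d` (`UV ≡ 1 (mod d)`) and `dS` integral,
`S` symmetric: reindex `L ↦ UL` on `M_{m,n}(ℤ/d)`; the phase only sees `L mod d` (`siegelThetaSeriesTerm_add_smul`, A–Z (4.10)).
C4 uses it with `U, V` from B5 (`UᵀT_ijU = n·T_il`, `UV = n·1`, `n ⊥ c`, `V ↦ n̄V`), `d = |c|`, `S = (a/c)`, `T = (a·sgn c)`. -/
theorem siegelGaussSum_conj {m n : ℕ} {Q : Matrix (Fin m) (Fin m) ℤ} (hQ : Q.IsSymm) (hQe : ∀ i, Even (Q i i))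
    {S' : Matrix (Fin n) (Fin n) ℂ} (hS : S'.IsSymm) {d : ℕ} (hd : 0 < d) {T : Matrix (Fin n) (Fin n) ℤ}
    (hdS : (d : ℂ) • S' = T.map ((↑) : ℤ → ℂ)) {U V : Matrix (Fin m) (Fin m) ℤ}
    (hUV : ∀ r s, (d : ℤ) ∣ (U * V - 1) r s) :
    siegelGaussSum (Uᵀ * Q * U) d S' = siegelGaussSum Q d S' := by
  haveI : NeZero d := ⟨hd.ne'⟩
  -- `U`, `V` modulo `d` are mutually inverse
  set Ub : Matrix (Fin m) (Fin m) (ZMod d) := U.map ((↑) : ℤ → ZMod d) with hUb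
  set Vb : Matrix (Fin m) (Fin m) (ZMod d) := V.map ((↑) : ℤ → ZMod d) with hVb
  have hUVb : Ub * Vb = 1 := by
    rw [hUb, hVb, ← map_mul_intCast]
    ext r s
    have h := (ZMod.intCast_zmod_eq_zero_iff_dvd ((U * V - 1) r s) d).2 (hUV r s)
    rw [Matrix.sub_apply, Int.cast_sub, sub_eq_zero] at h
    rw [Matrix.map_apply, h, Matrix.one_apply, Matrix.one_apply]
    split_ifs <;> simp
  have hVUb : Vb * Ub = 1 := mul_eq_one_comm.1 hUVb
  -- `Fin d`-indexed sums as `ZMod d`-indexed sums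
  have hval : ∀ x : Fin d, ((ZMod.finEquiv d).toEquiv x).val = (x : ℕ) := by
    intro x
    obtain ⟨k, rfl⟩ : ∃ k, d = k + 1 := ⟨d - 1, (Nat.succ_pred_eq_of_pos hd).symm⟩
    rfl
  have hA : ∀ Q' : Matrix (Fin m) (Fin m) ℤ,
      ∑ L : Matrix (Fin m) (Fin n) (Fin d), siegelThetaSeriesTerm Q' S' (L.map fun x => ((x : ℕ) : ℤ)) =
        ∑ X : Matrix (Fin m) (Fin n) (ZMod d), siegelThetaSeriesTerm Q' S' (X.map fun x => ((x.val : ℕ) : ℤ)) := by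
    intro Q'
    refine Fintype.sum_equiv (ZMod.finEquiv d).toEquiv.mapMatrix _ _ fun L => ?_
    congr 1
    ext r s
    simp only [Equiv.mapMatrix_apply, Matrix.map_apply]
    exact (congrArg (fun t : ℕ => (t : ℤ)) (hval (L r s))).symm
  -- lift / reduce
  have hrl : ∀ X : Matrix (Fin m) (Fin n) (ZMod d), (X.map fun x => ((x.val : ℕ) : ℤ)).map ((↑) : ℤ → ZMod d) = X := by
    intro X; ext r s; simp [Matrix.map_apply]
  have hper : ∀ M : Matrix (Fin m) (Fin n) ℤ, siegelThetaSeriesTerm Q S' M =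
      siegelThetaSeriesTerm Q S' ((M.map ((↑) : ℤ → ZMod d)).map fun x => ((x.val : ℕ) : ℤ)) := by
    intro M
    have hM : M = ((M.map ((↑) : ℤ → ZMod d)).map fun x => ((x.val : ℕ) : ℤ)) + (d : ℤ) • M.map (fun z => z / (d : ℤ)) := by
      ext r s
      simp only [Matrix.add_apply, Matrix.map_apply, Matrix.smul_apply, smul_eq_mul, ZMod.val_intCast]
      rw [mul_comm]
      exact (Int.emod_add_ediv_mul _ _).symm
    have hdS' : (((d : ℕ) : ℤ) : ℂ) • S' = T.map ((↑) : ℤ → ℂ) := by rw [Int.cast_natCast]; exact hdS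
    conv_lhs => rw [hM]
    exact siegelThetaSeriesTerm_add_smul hQ hQe hS hdS' _ _
  have hredU : ∀ X : Matrix (Fin m) (Fin n) (ZMod d),
      (U * X.map fun x => ((x.val : ℕ) : ℤ)).map ((↑) : ℤ → ZMod d) = Ub * X := by
    intro X; rw [map_mul_intCast, hrl]
  let e : Matrix (Fin m) (Fin n) (ZMod d) ≃ Matrix (Fin m) (Fin n) (ZMod d) :=
    ⟨fun X => Ub * X, fun X => Vb * X, fun X => by simp only; rw [← Matrix.mul_assoc, hVUb, Matrix.one_mul],
      fun X => by simp only; rw [← Matrix.mul_assoc, hUVb, Matrix.one_mul]⟩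
  have he : ∀ X, e X = Ub * X := fun X => rfl
  have hsum : ∑ X : Matrix (Fin m) (Fin n) (ZMod d), siegelThetaSeriesTerm (Uᵀ * Q * U) S' (X.map fun x => ((x.val : ℕ) : ℤ)) =
      ∑ X : Matrix (Fin m) (Fin n) (ZMod d), siegelThetaSeriesTerm Q S' (X.map fun x => ((x.val : ℕ) : ℤ)) := by
    calc ∑ X : Matrix (Fin m) (Fin n) (ZMod d), siegelThetaSeriesTerm (Uᵀ * Q * U) S' (X.map fun x => ((x.val : ℕ) : ℤ))
        = ∑ X : Matrix (Fin m) (Fin n) (ZMod d), siegelThetaSeriesTerm Q S' ((e X).map fun x => ((x.val : ℕ) : ℤ)) := by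
          refine Finset.sum_congr rfl fun X _ => ?_
          rw [siegelThetaSeriesTerm_conj, hper (U * _), hredU, he]
      _ = ∑ X : Matrix (Fin m) (Fin n) (ZMod d), siegelThetaSeriesTerm Q S' (X.map fun x => ((x.val : ℕ) : ℤ)) :=
          Fintype.sum_equiv e _ _ fun X => rfl
  rw [siegelGaussSum_def, siegelGaussSum_def]
  exact congrArg (fun z => ((d : ℂ) ^ (m * n))⁻¹ * z) ((hA _).trans (hsum.trans (hA _).symm))

/-! ## §H C4 assembled from B5 and C1 (taken as HYPOTHESES) — the interface check (PROVED gen 8)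

With E2′, C3a, C3b and `det_brandtGram` in hand, the gen-6 assembly item C4 is a theorem modulo exactly B5 and C1,
whose gen-6 signatures are consumed VERBATIM below (so a prover closing B5 and C1 as typed closes C4, hence H1). -/

/-- **C3a (g6, proved there; copied).** `G_d(T, nQ) = G_d(nT, Q)`. -/
theorem siegelGaussSum_natCast_smul {m k : ℕ} (Q : Matrix (Fin m) (Fin m) ℤ) (n d : ℕ) (T : Matrix (Fin k) (Fin k) ℂ) :
    siegelGaussSum ((n : ℤ) • Q) d T = siegelGaussSum Q d ((n : ℂ) • T) := by
  simp only [siegelGaussSum]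
  refine congrArg₂ (· * ·) rfl (Finset.sum_congr rfl fun L _ => ?_)
  rw [siegelThetaSeriesTerm_def, siegelThetaSeriesTerm_def]
  have hmap : ((n : ℤ) • Q).map ((↑) : ℤ → ℂ) = (n : ℂ) • Q.map ((↑) : ℤ → ℂ) := by
    ext i j; simp only [Matrix.map_apply, Matrix.smul_apply, smul_eq_mul, Int.cast_mul, Int.cast_natCast]
  simp only [hmap, Matrix.mul_smul, Matrix.smul_mul]

/-- **C4 from B5 + C1 (gen 8, PROVED).** For `c = 0` take `γ' = γ`; for `c ≠ 0` take `n, U, V` from B5 at `|c|`, the matrix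
`γ' = (na, −v; c, u)` (`u·na + v·c = 1`), C1 for `γ' ∈ Γ₀(N)γT^ℤ`, and
`G(a/c,[T_ij]) = G(a/c,[T_ij][U])` (E2′ with `V' = n̄V`) `= G(a/c, n[T_il])` (B5) `= G(na/c,[T_il])` (C3a). -/
theorem exists_thetaCuspValue_brandtGram_eq_sameRow_of [NeZero (Nplus * Nminus)] (i j l : ClassSet S.O)
    (hB5 : ∀ c : ℕ, 0 < c → ∃ n : ℕ, n.Coprime c ∧ n ≡ 1 [MOD Nat.gcd c ((Nplus * Nminus) / Nat.gcd (Nplus * Nminus) c)] ∧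
      ∃ U V : Matrix (Fin 4) (Fin 4) ℤ,
        Uᵀ * brandtGram S i j * U = (n : ℤ) • brandtGram S i l ∧ U * V = (n : ℤ) • (1 : Matrix (Fin 4) (Fin 4) ℤ))
    (hC1 : ∀ γ γ' : SL(2, ℤ), γ 1 0 ≠ 0 → γ' 1 0 = γ 1 0 → ∀ n : ℤ, (γ 1 0 : ℤ) ∣ γ' 0 0 - n * γ 0 0 →
      ((Nat.gcd (γ 1 0).natAbs ((Nplus * Nminus) / Nat.gcd (Nplus * Nminus) (γ 1 0).natAbs) : ℕ) : ℤ) ∣ n - 1 →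
      ∃ δ ∈ CongruenceSubgroup.Gamma0 (Nplus * Nminus), ∃ h : ℤ, γ' = δ * γ * ModularGroup.T ^ h)
    (γ : SL(2, ℤ)) :
    ∃ γ' : SL(2, ℤ), (∃ δ ∈ CongruenceSubgroup.Gamma0 (Nplus * Nminus), ∃ h : ℤ, γ' = δ * γ * ModularGroup.T ^ h) ∧
      thetaCuspValue (brandtGram S i j) γ = thetaCuspValue (brandtGram S i l) γ' := by
  by_cases hc : γ 1 0 = 0
  · refine ⟨γ, ⟨1, one_mem _, 0, by simp⟩, ?_⟩
    rw [thetaCuspValue, thetaCuspValue, if_pos hc, if_pos hc]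
  -- data from B5 at `|c|`
  have hd : 0 < (γ 1 0).natAbs := Int.natAbs_pos.2 hc
  obtain ⟨n, hn, hng, U, V, hU, hUV⟩ := hB5 (γ 1 0).natAbs hd
  -- `γ' = (na, -v; c, u)`
  have hac : IsCoprime (γ 0 0 : ℤ) (γ 1 0) := by
    refine ⟨γ 1 1, -(γ 0 1), ?_⟩
    have hdet := γ.prop
    rw [Matrix.det_fin_two] at hdet
    linear_combination hdet
  have hnd : IsCoprime (n : ℤ) ((γ 1 0).natAbs : ℤ) := Nat.isCoprime_iff_coprime.2 hn
  have hnc : IsCoprime (n : ℤ) (γ 1 0) := by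
    rcases Int.natAbs_eq (γ 1 0) with h | h
    · rw [h]; exact hnd
    · rw [h]; exact hnd.neg_right
  obtain ⟨u, v, huv⟩ := hnc.mul_left hac
  let γ' : SL(2, ℤ) := ⟨!![(n : ℤ) * γ 0 0, -v; γ 1 0, u], by rw [Matrix.det_fin_two_of]; linear_combination huv⟩
  have h10 : γ' 1 0 = γ 1 0 := rfl
  have h00 : γ' 0 0 = n * γ 0 0 := rfl
  have hc' : γ' 1 0 ≠ 0 := by rw [h10]; exact hc
  -- C1
  have hg : ((Nat.gcd (γ 1 0).natAbs ((Nplus * Nminus) / Nat.gcd (Nplus * Nminus) (γ 1 0).natAbs) : ℕ) : ℤ) ∣ (n : ℤ) - 1 := by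
    have h := Nat.modEq_iff_dvd.1 hng.symm
    rwa [Nat.cast_one] at h
  obtain ⟨δ, hδ, h, hγ'⟩ := hC1 γ γ' hc h10 n (by rw [h00, sub_self]; exact dvd_zero _) hg
  refine ⟨γ', ⟨δ, hδ, h, hγ'⟩, ?_⟩
  -- the Gauss-sum chain
  have hQ := brandtGram_isSymm S i j
  have hQe := even_brandtGram_diag S i j
  have hS : (one1 (((γ 0 0 : ℤ) : ℂ) / ((γ 1 0 : ℤ) : ℂ))).IsSymm := SiegelModularForm.one1_transpose _
  have hc0 : ((γ 1 0 : ℤ) : ℂ) ≠ 0 := by exact_mod_cast hc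
  have hsc : (((γ 1 0).sign : ℤ) : ℂ) * ((γ 1 0 : ℤ) : ℂ) = (((γ 1 0).natAbs : ℕ) : ℂ) := by
    have h := congrArg (fun z : ℤ => (z : ℂ)) (Int.sign_mul_self_eq_natAbs (γ 1 0))
    simpa only [Int.cast_mul, Int.cast_natCast] using h
  have hdS : (((γ 1 0).natAbs : ℕ) : ℂ) • one1 (((γ 0 0 : ℤ) : ℂ) / ((γ 1 0 : ℤ) : ℂ)) =
      (one1 (γ 0 0 * (γ 1 0).sign)).map ((↑) : ℤ → ℂ) := by
    rw [one1_map, smul_one1]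
    congr 1
    field_simp
    push_cast
    linear_combination (-((γ 0 0 : ℤ) : ℂ)) * hsc
  obtain ⟨nb, w, hnb⟩ := hnd
  have hUV' : ∀ r s, (((γ 1 0).natAbs : ℕ) : ℤ) ∣ (U * (nb • V) - 1) r s := by
    intro r s
    rw [Matrix.mul_smul, hUV, smul_smul, Matrix.sub_apply, Matrix.smul_apply, Matrix.one_apply]
    split_ifs
    · exact ⟨-w, by rw [smul_eq_mul, mul_one]; linear_combination hnb⟩
    · simp
  have hG : siegelGaussSum (brandtGram S i j) (γ 1 0).natAbs (one1 (((γ 0 0 : ℤ) : ℂ) / ((γ 1 0 : ℤ) : ℂ))) =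
      siegelGaussSum (brandtGram S i l) (γ 1 0).natAbs (one1 ((((n : ℤ) * γ 0 0 : ℤ) : ℂ) / ((γ 1 0 : ℤ) : ℂ))) := by
    rw [← siegelGaussSum_conj hQ hQe hS hd hdS hUV', hU, siegelGaussSum_natCast_smul, smul_one1]
    congr 2
    push_cast
    ring
  rw [thetaCuspValue, thetaCuspValue, if_neg hc, if_neg hc', det_brandtGram, det_brandtGram, h10, h00, hG]

/-! ## §I H1 modulo exactly {B5, C1} — the gen-6 §D composition re-run on the gen-8 proofs (kernel-checked, 0 sorries)

`B5Statement` / `C1Statement` are the gen-6 signatures of B5 (`exists_brandtGram_sublattice_datum`, with `hN`/`hcop` moved to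
where a prover has them) and C1 (`exists_gamma0_mul_T_zpow`) as `Prop`s; L1 and C2 are the gen-5/6 proofs repeated verbatim. -/

/-- B5 (gen-6 signature) as a hypothesis. -/
def B5Statement (i j l : ClassSet S.O) : Prop :=
  ∀ c : ℕ, 0 < c → ∃ n : ℕ, n.Coprime c ∧ n ≡ 1 [MOD Nat.gcd c ((Nplus * Nminus) / Nat.gcd (Nplus * Nminus) c)] ∧
    ∃ U V : Matrix (Fin 4) (Fin 4) ℤ,
      Uᵀ * brandtGram S i j * U = (n : ℤ) • brandtGram S i l ∧ U * V = (n : ℤ) • (1 : Matrix (Fin 4) (Fin 4) ℤ)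

/-- C1 (gen-6 signature) as a hypothesis. -/
def C1Statement (N : ℕ) : Prop :=
  ∀ γ γ' : SL(2, ℤ), γ 1 0 ≠ 0 → γ' 1 0 = γ 1 0 → ∀ n : ℤ, (γ 1 0 : ℤ) ∣ γ' 0 0 - n * γ 0 0 →
    ((Nat.gcd (γ 1 0).natAbs (N / Nat.gcd N (γ 1 0).natAbs) : ℕ) : ℤ) ∣ n - 1 →
    ∃ δ ∈ CongruenceSubgroup.Gamma0 N, ∃ h : ℤ, γ' = δ * γ * ModularGroup.T ^ h

/-- **L1 (gen 5, PROVED there; repeated).** Equal values of all `SL₂(ℤ)`-translates ⇒ the difference is cuspidal. -/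
theorem isCuspForm_sub_of_forall_valueAtInfty_slash_eq {N : ℕ} [NeZero N] (f g : ModularForm (CongruenceSubgroup.Gamma0 N) 2)
    (h : ∀ γ : SL(2, ℤ), UpperHalfPlane.valueAtInfty (⇑f ∣[(2 : ℤ)] (γ : GL (Fin 2) ℝ)) =
      UpperHalfPlane.valueAtInfty (⇑g ∣[(2 : ℤ)] (γ : GL (Fin 2) ℝ))) :
    ModularForm.IsCuspForm (f - g) := by
  have hF : (⇑f - ⇑g) ∈ gamma0Space N 2 := Submodule.sub_mem _ (coe_mem_formSpace f) (coe_mem_formSpace g)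
  have hlim : ∀ (u : ModularForm (CongruenceSubgroup.Gamma0 N) 2) (γ : SL(2, ℤ)),
      Tendsto (⇑u ∣[(2 : ℤ)] (γ : GL (Fin 2) ℝ)) UpperHalfPlane.atImInfty
        (𝓝 (UpperHalfPlane.valueAtInfty (⇑u ∣[(2 : ℤ)] (γ : GL (Fin 2) ℝ)))) := by
    intro u γ
    have := tendsto_cosetSlash (coe_mem_formSpace u) ((γ⁻¹ : SL(2, ℤ)) : SL(2, ℤ) ⧸ CongruenceSubgroup.Gamma0 N)
    rwa [cosetSlash_mk (slash_eq_of_mem_gamma0Space (coe_mem_formSpace u)), inv_inv] at this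
  have h0 : ∀ γ : SL(2, ℤ), UpperHalfPlane.IsZeroAtImInfty ((⇑f - ⇑g) ∣[(2 : ℤ)] (γ : GL (Fin 2) ℝ)) := by
    intro γ
    have hsub : (⇑f - ⇑g) ∣[(2 : ℤ)] (γ : GL (Fin 2) ℝ) =
        ⇑f ∣[(2 : ℤ)] (γ : GL (Fin 2) ℝ) - ⇑g ∣[(2 : ℤ)] (γ : GL (Fin 2) ℝ) := by
      rw [sub_eq_add_neg, SlashAction.add_slash, SlashAction.neg_slash, ← sub_eq_add_neg]
    show Tendsto ((⇑f - ⇑g) ∣[(2 : ℤ)] (γ : GL (Fin 2) ℝ)) UpperHalfPlane.atImInfty (𝓝 0)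
    rw [hsub]
    have := (hlim f γ).sub (hlim g γ)
    rwa [h γ, sub_self] at this
  refine ⟨cuspFormOfVanishing (⇑f - ⇑g) hF h0, ?_⟩
  ext τ
  rw [CuspForm.toModularFormₗ_apply, ModularForm.sub_apply]
  rfl

/-- **C2 (gen 6, PROVED there; repeated).** `v(f ∣ δ γ T^h) = v(f ∣ γ)` for `δ ∈ Γ₀(N)`. -/
theorem valueAtInfty_slash_gamma0_mul_T_zpow {N : ℕ} [NeZero N] {k : ℤ} (f : ModularForm (CongruenceSubgroup.Gamma0 N) k)
    (γ : SL(2, ℤ)) {δ : SL(2, ℤ)} (hδ : δ ∈ CongruenceSubgroup.Gamma0 N) (h : ℤ) :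
    UpperHalfPlane.valueAtInfty (⇑f ∣[k] ((δ * γ * ModularGroup.T ^ h : SL(2, ℤ)) : GL (Fin 2) ℝ)) =
      UpperHalfPlane.valueAtInfty (⇑f ∣[k] (γ : GL (Fin 2) ℝ)) := by
  have hγ : ⇑f ∣[k] ((δ * γ * ModularGroup.T ^ h : SL(2, ℤ)) : GL (Fin 2) ℝ) =
      transl h (⇑f ∣[k] (γ : GL (Fin 2) ℝ)) := by
    rw [coeGL_mul, coeGL_mul, SlashAction.slash_mul, SlashAction.slash_mul,
      slash_eq_of_mem_gamma0Space (coe_mem_formSpace f) δ hδ, slash_T_zpow_eq_transl]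
  have hlim : Tendsto (⇑f ∣[k] (γ : GL (Fin 2) ℝ)) UpperHalfPlane.atImInfty
      (𝓝 (UpperHalfPlane.valueAtInfty (⇑f ∣[k] (γ : GL (Fin 2) ℝ)))) := by
    have := tendsto_cosetSlash (coe_mem_formSpace f) ((γ⁻¹ : SL(2, ℤ)) : SL(2, ℤ) ⧸ CongruenceSubgroup.Gamma0 N)
    rwa [cosetSlash_mk (slash_eq_of_mem_gamma0Space (coe_mem_formSpace f)), inv_inv] at this
  rw [hγ]
  exact (hlim.comp (tendsto_T_zpow_smul_atImInfty h)).limUnder_eq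

/-- **H1, same row, modulo {B5, C1}.** -/
theorem brandtTheta_sub_isCuspForm_sameRow_of [NeZero (Nplus * Nminus)] (i j l : ClassSet S.O)
    (hB5 : B5Statement S i j l) (hC1 : C1Statement (Nplus * Nminus)) :
    ModularForm.IsCuspForm (S.brandtTheta i j - S.brandtTheta i l) := by
  refine isCuspForm_sub_of_forall_valueAtInfty_slash_eq _ _ fun γ => ?_
  obtain ⟨γ', ⟨δ, hδ, h, rfl⟩, hv⟩ := exists_thetaCuspValue_brandtGram_eq_sameRow_of S i j l hB5 hC1 γ
  rw [valueAtInfty_slash_brandtTheta S i j γ, hv, ← valueAtInfty_slash_brandtTheta S i l,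
    valueAtInfty_slash_gamma0_mul_T_zpow (S.brandtTheta i l) γ hδ h]

/-- **H1 exactly as consumed by k2's closing chain, modulo {B5 (all same-row triples), C1}.** -/
theorem brandtTheta_sub_isCuspForm_of [NeZero (Nplus * Nminus)]
    (hB5 : ∀ i j l : ClassSet S.O, B5Statement S i j l) (hC1 : C1Statement (Nplus * Nminus))
    (i j k l : ClassSet S.O) : ModularForm.IsCuspForm (S.brandtTheta i j - S.brandtTheta k l) := by
  have h1 := brandtTheta_sub_isCuspForm_sameRow_of S i j l (hB5 i j l) hC1
  have h2 := brandtTheta_sub_isCuspForm_sameRow_of S l i k (hB5 l i k) hC1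
  rw [S.brandtTheta_symm l i, S.brandtTheta_symm l k] at h2
  have h3 : S.brandtTheta i j - S.brandtTheta k l =
      (S.brandtTheta i j - S.brandtTheta i l) + (S.brandtTheta i l - S.brandtTheta k l) := by
    abel
  rw [ModularForm.IsCuspForm, h3]
  exact Submodule.add_mem _ h1 h2

/-! ## §J C1 PROVED (gen 8): `Γ₀(N)`-double-coset recognition `γ' ∈ Γ₀(N) γ T^ℤ`

`δ_h := γ' T^{-h} γ⁻¹` has lower-left entry `c (d − d' + h c)`; with `G = (N, c)`, `M = N/G`, `g = (c, M)`:
`g ∣ a' − a` (from `c ∣ a' − n a`, `g ∣ n − 1`), hence `g ∣ d − d' = d d'(a' − a) + c (b d' − b' d)`; Bézout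
`g = |c| x + M y` gives `h` with `M ∣ d − d' + h c`, and then `N = G M ∣ c (d − d' + h c)`. -/
theorem c1Statement_holds (N : ℕ) [NeZero N] : C1Statement N := by
  intro γ γ' hc hcc n hn hg
  have hdet : γ 0 0 * γ 1 1 - γ 0 1 * γ 1 0 = 1 := by
    have h := γ.prop; rw [Matrix.det_fin_two] at h; exact h
  have hdet' : γ' 0 0 * γ' 1 1 - γ' 0 1 * γ 1 0 = 1 := by
    have h := γ'.prop; rw [Matrix.det_fin_two, hcc] at h; exact h
  -- moduli
  set G : ℕ := Nat.gcd N (γ 1 0).natAbs with hG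
  set M : ℕ := N / G with hM
  set g : ℕ := Nat.gcd (γ 1 0).natAbs M with hg'
  have hgc : (g : ℤ) ∣ γ 1 0 := (Int.natCast_dvd_natCast.2 (Nat.gcd_dvd_left _ _)).trans (Int.natAbs_dvd.2 dvd_rfl)
  have hGc : (G : ℤ) ∣ γ 1 0 := (Int.natCast_dvd_natCast.2 (Nat.gcd_dvd_right _ _)).trans (Int.natAbs_dvd.2 dvd_rfl)
  have hNM : (N : ℤ) = G * M := by rw [hM]; exact_mod_cast (Nat.mul_div_cancel' (Nat.gcd_dvd_left _ _)).symm
  -- `g ∣ d - d'`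
  have h1 : (g : ℤ) ∣ γ' 0 0 - γ 0 0 := by
    have : (γ' 0 0 : ℤ) - γ 0 0 = (γ' 0 0 - n * γ 0 0) + (n - 1) * γ 0 0 := by ring
    rw [this]; exact dvd_add (hgc.trans hn) (hg.mul_right _)
  have hdd : (g : ℤ) ∣ γ 1 1 - γ' 1 1 := by
    have : (γ 1 1 : ℤ) - γ' 1 1 = γ 1 1 * γ' 1 1 * (γ' 0 0 - γ 0 0) + γ 1 0 * (γ 0 1 * γ' 1 1 - γ' 0 1 * γ 1 1) := by
      linear_combination γ' 1 1 * hdet - γ 1 1 * hdet'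
    rw [this]; exact dvd_add (h1.mul_left _) (hgc.mul_right _)
  obtain ⟨t, ht⟩ := hdd
  -- Bézout and the shift
  have hbez : (g : ℤ) = ((γ 1 0).natAbs : ℤ) * Nat.gcdA (γ 1 0).natAbs M + (M : ℤ) * Nat.gcdB (γ 1 0).natAbs M :=
    Nat.gcd_eq_gcd_ab _ _
  have habs : (((γ 1 0).natAbs : ℕ) : ℤ) = (γ 1 0).sign * γ 1 0 := (Int.sign_mul_self_eq_natAbs _).symm
  set x : ℤ := Nat.gcdA (γ 1 0).natAbs M with hx
  set y : ℤ := Nat.gcdB (γ 1 0).natAbs M with hy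
  set h : ℤ := -((γ 1 0).sign * x * t) with hh
  have hMdvd : (M : ℤ) ∣ γ 1 1 - γ' 1 1 + h * γ 1 0 :=
    ⟨t * y, by rw [ht, hh]; linear_combination t * hbez + x * t * habs⟩
  refine ⟨γ' * (ModularGroup.T ^ h)⁻¹ * γ⁻¹, ?_, h, by group⟩
  have hentry : ((γ' * (ModularGroup.T ^ h)⁻¹ * γ⁻¹ : SL(2, ℤ)) : Matrix (Fin 2) (Fin 2) ℤ) 1 0 =
      γ 1 0 * (γ 1 1 - γ' 1 1 + h * γ 1 0) := by
    rw [← _root_.zpow_neg, Matrix.SpecialLinearGroup.coe_mul, Matrix.SpecialLinearGroup.coe_mul, ModularGroup.coe_T_zpow,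
      Matrix.SpecialLinearGroup.coe_inv, Matrix.adjugate_fin_two]
    simp [Matrix.mul_apply, Fin.sum_univ_two]
    rw [hcc]; ring
  rw [CongruenceSubgroup.Gamma0_mem, hentry, ZMod.intCast_zmod_eq_zero_iff_dvd]
  obtain ⟨k, hk⟩ := hMdvd
  obtain ⟨c₁, hc₁⟩ := hGc
  refine ⟨c₁ * k, ?_⟩
  rw [hk, hNM, hc₁]; ring

/-- **C1 in the gen-6 signature.** -/
theorem exists_gamma0_mul_T_zpow {N : ℕ} [NeZero N] (γ γ' : SL(2, ℤ)) (hc : γ 1 0 ≠ 0) (hcc : γ' 1 0 = γ 1 0) {n : ℤ}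
    (hn : (γ 1 0 : ℤ) ∣ γ' 0 0 - n * γ 0 0)
    (hg : ((Nat.gcd (γ 1 0).natAbs (N / Nat.gcd N (γ 1 0).natAbs) : ℕ) : ℤ) ∣ n - 1) :
    ∃ δ ∈ CongruenceSubgroup.Gamma0 N, ∃ h : ℤ, γ' = δ * γ * ModularGroup.T ^ h :=
  c1Statement_holds N γ γ' hc hcc n hn hg

/-- **H1 modulo B5 alone (gen 8).** -/
theorem brandtTheta_sub_isCuspForm_of_B5 [NeZero (Nplus * Nminus)]
    (hB5 : ∀ i j l : ClassSet S.O, B5Statement S i j l)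
    (i j k l : ClassSet S.O) : ModularForm.IsCuspForm (S.brandtTheta i j - S.brandtTheta k l) :=
  brandtTheta_sub_isCuspForm_of S hB5 (c1Statement_holds _) i j k l

end Summit.ABC.ABC.Cruxes.SteinbergCore.StubIdeasK1G8

/-! ## H1 assembled (gen 9) -/

namespace Summit.ABC.ABC.Cruxes.SteinbergCore.StubIdeasK1G9

open Literature.NumberTheory.Automorphic Literature.NumberTheory.Automorphic.Brandt

variable {Nplus Nminus : ℕ} (S : XiSetup Nplus Nminus)

/-- B2 holds (gen 7's `exists_mem_order_reducedNorm_modEq_of_not_dvd`, `0 < N⁺` from `NeZero (N⁺N⁻)`). -/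
theorem b2Statement_holds [NeZero (Nplus * Nminus)] : B2Statement S := by
  intro p hp hpN e t ht
  haveI : Fact p.Prime := ⟨hp⟩
  have hN : 0 < Nplus := Nat.pos_of_ne_zero fun h => NeZero.ne (Nplus * Nminus) (by rw [h, zero_mul])
  exact StubIdeasK1G7.exists_mem_order_reducedNorm_modEq_of_not_dvd S hpN hN e ht

/-- B5 holds for coprime `(N⁺, N⁻)` (gen 9), in gen 8's spelling of the statement. -/
theorem b5Statement_holds [NeZero (Nplus * Nminus)] (hcop : Nplus.Coprime Nminus) (i j l : ClassSet S.O) :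
    StubIdeasK1G8.B5Statement S i j l :=
  b5Statement_of S hcop (b2Statement_holds S) i j l

/-- **H1 (complete, hypotheses explicit).** Every difference of Brandt theta series `Θ_ij − Θ_kl` of an Eichler order
of level `(N⁺, N⁻)`, `(N⁺, N⁻) = 1`, is a cusp form of weight 2 and level `Γ₀(N⁺N⁻)`. [cite: EichlerLNM320, Ch. IV §1]
[cite: Pizer1980, Prop. 2.15] [cite: HijikataPizerShemanske1989] -/
theorem brandtTheta_sub_isCuspForm [NeZero (Nplus * Nminus)] (hcop : Nplus.Coprime Nminus)
    (i j k l : ClassSet S.O) : ModularForm.IsCuspForm (S.brandtTheta i j - S.brandtTheta k l) :=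
  StubIdeasK1G8.brandtTheta_sub_isCuspForm_of_B5 S (fun i' j' l' => b5Statement_holds S hcop i' j' l') i j k l

/-- **H1 (unconditional).** `NeZero (N⁺N⁻)` and `(N⁺,N⁻) = 1` are properties of every Brandt setup
(`XiSetup.nplus_pos`, `XiSetup.squarefree`, `XiSetup.coprime`). -/
theorem brandtTheta_sub_isCuspForm' (i j k l : ClassSet S.O) :
    ModularForm.IsCuspForm (S.brandtTheta i j - S.brandtTheta k l) := by
  haveI : NeZero (Nplus * Nminus) := ⟨mul_ne_zero S.nplus_pos.ne' S.squarefree.ne_zero⟩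
  exact brandtTheta_sub_isCuspForm S S.coprime i j k l

/-- **k2's H1, verbatim** (`ThetaTransferG3.brandtTheta_sub_isCuspForm`, the hypothesis `hΘ` of
`stub_xiDegreeComparison_of_thetaTransfer`) — PROVED. -/
theorem thetaTransfer_H1 :
    ∀ (Nplus Nminus : ℕ) (S : XiSetup Nplus Nminus) [Fintype (ClassSet S.O)] (i j k l : ClassSet S.O),
      ModularForm.IsCuspForm (S.brandtTheta i j - S.brandtTheta k l) :=
  fun _ _ S _ i j k l => brandtTheta_sub_isCuspForm' S i j k l

end Summit.ABC.ABC.Cruxes.SteinbergCore.StubIdeasK1G9
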